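import Mathlib
import Literature.NumberTheory.LFunctions.Zhang2022.SkeletonPartTwo
import Literature.NumberTheory.LFunctions.Zhang2022.SkeletonAssembly
import HarnessLib

/-!
# Zhang (2022), typed statements: §11a — the reduction of Proposition 2.6 to (11.1), the
# objects `g̃₁, g̃₂, J̃_μ, η_±`, and Lemma 11.1 with the displayed steps of its proof

Topic `Literature/NumberTheory/LFunctions/Zhang2022` (Landau–Siegel audit tree; verdict-neutral).
Y. Zhang, *Discrete mean estimates and the Landau–Siegel zero*, arXiv:2211.02515v1 (2022)
[Zhang2022LandauSiegel], §11 "Proof of Proposition 2.6", PDF pp. 62–64, tex L3189–L3288 — **an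
unrefereed manuscript under adjudication: every `def … : Prop` below is a CLAIM OF THE MANUSCRIPT,
STATED NOT ASSERTED; nothing here asserts or denies its Theorems 1–2.** Companion of the banked
skeleton (`Skeleton*`), whose nodes are cited, never restated: (11.1) = `Skeleton.Eval111`
(`Skeleton.xi3sq`), Lemma 11.1 = `Skeleton.Lemma111`, Lemma 11.2 = `Skeleton.Lemma112`, the §11
deduction = `Skeleton.Ded111`, edges `Skeleton.eval111_of`, `Skeleton.prop26_of_evals`; objects
`g̃₁, g̃₂ = Skeleton.gtilde1/2` (`Z22:§11.u002/u003`, p.62 L3202/L3205), `J̃₁ = Skeleton.Jtilde1`,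
`J̃₂(1−s,ψ̄) = Skeleton.Jtilde2Bar`, `η_± = Skeleton.etaPM D (±1)` (`Z22:§11.u005`, p.63 L3213),
`g = Skeleton.gW` ((4.1), `Λ = 𝓛³⁰`), `f̃ = Skeleton.ftilde` (2.28). This file types the FINER
proof-step claims of §11a around them (campaign DAG ids `Z22:…`; PDF page / tex line):

| DAG node | p. / tex | decl here |
|---|---|---|
| `Z22:Prop2.6.pf` | p.62 L3189 | `Sec11DedP c′` + edge `sec11DedP_of` PROVED ((9.7) + (11.1) ⇒ Prop 2.6); `Sec11Ded c′` + `sec11Ded_of` (via the banked §11 nodes) |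
| `Z22:§11.u001` | p.62 L3193 | `Xi12Bound c′` + edge `xi12Bound_of_eval97` ("by §9, `Ξ₁₂ ≪ 𝔞𝔓`") |
| `Z22:(11.1)` | p.62 L3197 | `CauchyReduction c′` + `cauchyReduction_of`; (11.1) itself = `Skeleton.Eval111` |
| `Z22:§11.u002/u003` | p.62 L3202/L3205 | `gTilde1`, `gTilde2` (the printed `g̃₁, g̃₂` with explicit parentheses; `= Skeleton.gtilde1/2`, see TYPING NOTE) |
| `Z22:§11.u004` | p.63 L3209 | `JTilde1`, `JTilde2`, `JTilde2Bar` (over `gTilde1/2`); `Jtilde2` (over the banked `gtilde2`) |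
| — (L3216; proposed `Z22:§11.u005b`) | p.63 L3216 | `TailsClaimP` (tails of `J̃₁` contribute `≪ ε`); `TailsClaim` (banked-`g̃₁` form) |
| `Z22:Lem11.1`, `§11.u006`, `(11.2)`, `§11.u007`, `(11.3)` | p.63 L3220–L3235 | `Lemma111P` — **PROVED** (`lemma111P_holds`, `eq112P_and_eq113P_hold`), `Range112`, `Eq112P`, `Range113`, `Eq113P`, `lemma111P_iff` (printed Lemma 11.1); `Eq112`, `Eq113`, `lemma111_iff` (banked-`g̃₁` forms, `↔ Skeleton.Lemma111`) |
| `Z22:Lem11.1.pf` | p.63 L3238 | `Lemma111DedP` — PROVED (`lemma111DedP_holds`); `Lemma111Ded` |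
| `Z22:§11.u008`, `(11.4)` | p.63 L3240, L3244 | `GInvErf`, `Eq114` — PROVED (`gInvErf_holds`, `eq114_holds`) |
| `Z22:§11.u009` | p.63 L3248 | `uOf` (`u = log y / log P`) |
| `Z22:§11.u010–u012` | p.63 L3252–L3263 | `CaseA`, `StepU010`, `StepU011`, `StepU012` — PROVED (`stepU010_holds`, `stepU011_holds`, `stepU012_holds`) |
| `Z22:§11.u013–u015` | p.64 L3266–L3277 | `CaseB`, `StepU013`, `StepU014` (verbatim) / `StepU014corr`, `StepU015` — PROVED (`stepU013_holds`, `stepU014corr_holds`, `stepU015_holds`; the verbatim `StepU014` is the misprint) |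
| `Z22:§11.u016–u017` | p.64 L3280–L3288 | `Window0502`, `StepU016a`, `StepU016b`, `StepU017` — PROVED (`stepU016a_holds`, `stepU016b_holds`, `stepU017_holds`) |

Frames (the skeleton's, `SkeletonPropositions`): "`X ≪ Y`" ⇒ `∃ C, ForAllLarge (… X ≤ C·Y)`;
"`= A + O(ε)`", `ε = exp{−c𝓛¹⁰}` (§4 p. 20) ⇒ `∃ c > 0, ∃ C, ForAllLarge (… |X − A| ≤ C·exp(−c𝓛¹⁰))`
(as in `Skeleton.Lemma111`); "`O(𝓛⁻¹⁰)`" ⇒ `… ≤ C·(𝓛¹⁰)⁻¹`; exact identities ((11.4), the two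
symmetric-interval evaluations) are stated for every `D ≥ 2` (so that `𝓛 = log D > 0`, `log P > 0`).
Pure real-analysis steps (about `g`, `f̃`) carry no Assumption (A), as `Skeleton.Lemma111`; claims
about the character sums carry it, as `Skeleton.Lemma112`.

READING NOTES (typer's record, not a verdict): (a) p.63 L3216 cites "(5) and (5)" — malformed
references; (b) p.63 L3240 prints `𝓛 log x` where (4.1) has `𝓛¹⁵ log x` — `GInvErf` uses `𝓛¹⁵`
[sic noted]; (c) p.63 L3252 prints "`T^{0.502}η₊ ≤ y`" — `CaseA` reads `P^{0.502}η₊` (cases A, B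
split the (11.2)-range `[P^{0.502}η₊, P^{0.504}η₋]` at `P^{0.503}`) [sic noted]; (d) the citations
"(6.2)", "(6.3)", "(5.2)", "(5.3)" in this proof point at displays about other objects; what is used
is (4.2)–(4.3) (tree: `GaussWeight.abs_gWeight_sub_one_le`, `GaussWeight.gWeight_le`); (e) p.64
L3270–L3273 (`StepU014`): on `[0.502, 2u − 0.504]`, `z − u ≤ −(0.504 − u)`, so the integral is
`O(ε)`, not `2u − 1.006 + O(ε)` as printed (the printed values would sum to `500(u − 0.502) ≠ f̃(u)`);
both forms are typed (`StepU014` verbatim, `StepU014corr`); (11.2) itself is unaffected.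

TYPING NOTE (v2/v3, same night). When v2 was written the banked bodies of `Skeleton.gtilde1`,
`Skeleton.gtilde2` (`-500 * ∫ z in a..b, g + 500 * ∫ z in b..c, g`, no parentheses) let Lean's
integral binder (body parsed at precedence 60) capture the trailing `+ 500 * ∫ …`, i.e. they read
`−500(I₁ + I₂)` instead of the printed `−500·I₁ + 500·I₂`; this was reported and the skeleton owner
re-parenthesises the two bodies IN PLACE (cell ruling "SKEL-RULING gtilde (A)"), after which every
statement over `Skeleton.gtilde1/gtilde2/Jtilde1/Jtilde2Bar/Lemma111/Lemma112` means the printed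
objects. This file declares the printed objects with explicit parentheses — `gTilde1`, `gTilde2`,
`JTilde1`, `JTilde2`, `JTilde2Bar` — and Lemma 11.1 over them (`Lemma111P`, halves `Eq112P`/`Eq113P`,
`TailsClaimP`, `Lemma111DedP`, `Sec11DedP`); once the skeleton revision is in the tree these are
DEFINITIONALLY EQUAL to the skeleton's (`rfl` bridges then), and the v1 decls over the skeleton names
(`Jtilde2`, `TailsClaim`, `Eq112`, `Eq113`, `lemma111_iff`, `Lemma111Ded`, `Sec11Ded`) coincide with
their `…P` twins. No statement in this file depends on which parenthesisation the skeleton carries.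
**Lemma 11.1 as printed is DISCHARGED here**: `lemma111P_holds` (section `Discharge` — the printed
proof made rigorous with the tree's `Section4GaussianWeight`; standard axioms), together with the
displayed proof steps (`stepU010_holds` … `stepU017_holds`).

## References

* Y. Zhang, arXiv:2211.02515v1 (2022), §11 pp. 62–64; §2 (2.28); §4 (4.1)–(4.3); §9 (9.7).
  [cite: Zhang2022LandauSiegel, §11]
-/

noncomputable section

open Complex Real ComplexConjugate MeasureTheory Set

namespace Literature.NumberTheory.LFunctions.Zhang2022.Typed.Sec11A

open Literature.NumberTheory.LFunctions.Zhang2022.Skeleton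

/-! ## §11 head (p. 62): `Ξ₁₂ ≪ 𝔞𝔓` and the Cauchy reduction of Proposition 2.6 to (11.1) -/

section Head

variable (c' : ℝ)

/-- **`Z22:§11.u001`** — "By the result of Section 9, `Ξ₁₂ ≪ 𝔞𝒫`" (the result of §9 being (9.7),
`Skeleton.Eval97`: `Ξ₁₂ = 𝔠₂𝔞𝔓 + o(𝔓)`, with `𝔞 ≫ 1`). CLAIM, stated not asserted; derived from
its cited input in `xi12Bound_of_eval97`. [Z22 p.62, tex L3193]
[cite: Zhang2022LandauSiegel, §11 p. 62] -/
def Xi12Bound : Prop :=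
  ∃ C : ℝ, ForAllLarge fun D _ χ => AssumptionA D χ → xi12 c' χ ≤ C * frakA χ * frakP D

/-- **Edge for `Z22:§11.u001`**: (9.7) (`Skeleton.Eval97`) and `𝔞 ≫ 1` (`Skeleton.FrakALowerBound`,
discharged in `SkeletonAssembly`) give `Ξ₁₂ ≤ (|𝔠₂| + 1)𝔞𝔓` eventually. [Z22 p.62, tex L3193]
[cite: Zhang2022LandauSiegel, §11 p. 62] -/
theorem xi12Bound_of_eval97 (h97 : Eval97 c') (ha : FrakALowerBound) : Xi12Bound c' := by
  obtain ⟨a₀, ha₀, ha⟩ := ha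
  obtain ⟨D₁, hP⟩ := frakP_eventually_pos
  obtain ⟨D₀, h⟩ := (h97 a₀ ha₀).and ha
  refine ⟨|frakc2.re| + 1, max D₀ D₁, fun D _ χ hD hq hp hA => ?_⟩
  obtain ⟨h97', ha'⟩ := h D χ (le_trans (le_max_left _ _) hD) hq hp
  have hPpos : 0 < frakP D := hP D (le_trans (le_max_right _ _) hD)
  have haa : a₀ ≤ frakA χ := ha' hA
  have e2 := (abs_le.mp (h97' hA)).2
  have h1 : a₀ * frakP D ≤ frakA χ * frakP D := mul_le_mul_of_nonneg_right haa hPpos.le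
  have h2 : frakc2.re * frakA χ * frakP D ≤ |frakc2.re| * (frakA χ * frakP D) := by
    rw [← mul_assoc]
    exact mul_le_mul_of_nonneg_right
      (mul_le_mul_of_nonneg_right (le_abs_self _) (le_trans ha₀.le haa)) hPpos.le
  linarith

/-- **`Z22:(11.1)` (the reduction sentence)** — "Hence, by Cauchy's inequality, the proof of
Proposition 2.6 is reduced to showing that (11.1)": `Ξ₁₂ ≪ 𝔞𝔓` and (11.1) (`Skeleton.Eval111`:
`ΣΣ𝔠*|J₁ − ZJ₂(1−ρ,ψ̄)|²ω = o(𝔞𝔓)`) ⇒ Proposition 2.6 (`Skeleton.Prop26`). CLAIM (an inference),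
stated; proved from the non-negativity of the weights `𝔠*ω` in `cauchyReduction_of`. The display
(11.1) itself is the banked node `Skeleton.Eval111 c′` — not restated. [Z22 p.62, (11.1), tex L3196–L3199]
[cite: Zhang2022LandauSiegel, §11 (11.1) p. 62] -/
def CauchyReduction : Prop := Xi12Bound c' → Eval111 c' → Prop26 c'

/-- **Edge for `Z22:(11.1)`'s reduction**: Cauchy's inequality `(Ξ₃*)² ≤ (ΣΣ𝔠*|J₁−ZJ̄₂|²ω)·Ξ₁₂`
(`Skeleton.xiStar3_sq_le`) needs the weights `𝔠*(ρ,ψ)ω(ρ) ≥ 0`, i.e. Lemma 2.3 and Prop. 2.2 (i)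
(with `ψχ` primitive) — the skeleton's `pointwise_inputs`; given these, `CauchyReduction` holds
(variant of `Skeleton.prop26_of_evals`, which takes (9.7) instead of `Ξ₁₂ ≪ 𝔞𝔓`).
[Z22 p.62, tex L3196] [cite: Zhang2022LandauSiegel, §11 (11.1) p. 62] -/
theorem cauchyReduction_of (h22 : Prop22i) (h23 : Lemma23 c') (hprim : PsiChiPrimitive) :
    CauchyReduction c' := by
  intro h12 h111 ε hε
  obtain ⟨C, h12⟩ := h12
  obtain ⟨D₁, hP⟩ := frakP_eventually_pos
  set K : ℝ := max C 1 with hK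
  have hK0 : 0 < K := lt_of_lt_of_le one_pos (le_max_right _ _)
  set ε₁ : ℝ := ε ^ 2 / K with hε₁
  have hε₁0 : 0 < ε₁ := by positivity
  obtain ⟨D₀, h⟩ := ((h22.and h23).and (h111 ε₁ hε₁0)).and h12
  refine ⟨max (max D₀ D₁) 3, fun D _ χ hD hq hp hA => ?_⟩
  have hD3 : 3 ≤ D := le_trans (le_max_right _ _) hD
  have hD₀ : D₀ ≤ D := le_trans (le_trans (le_max_left _ _) (le_max_left _ _)) hD
  have hD₁ : D₁ ≤ D := le_trans (le_trans (le_max_right _ _) (le_max_left _ _)) hD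
  obtain ⟨⟨⟨h22', h23'⟩, h111'⟩, h12'⟩ := h D χ hD₀ hq hp
  obtain ⟨hc, hω, -⟩ := pointwise_inputs c' χ hD3 h23' h22' (fun x => hprim D χ x hD3 hp)
  have hPpos : 0 < frakP D := hP D hD₁
  set X : ℝ := frakA χ * frakP D with hX
  have hX0 : 0 ≤ X := mul_nonneg (frakA_nonneg χ) hPpos.le
  have hsq : xi3sq c' χ ≤ ε₁ * X := by rw [hX, ← mul_assoc]; exact h111' hA
  have h12'' : xi12 c' χ ≤ K * X := by
    have h1 : xi12 c' χ ≤ C * X := by rw [hX, ← mul_assoc]; exact h12' hA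
    exact le_trans h1 (mul_le_mul_of_nonneg_right (le_max_left C 1) hX0)
  have hcs := xiStar3_sq_le χ fun i hi => mul_nonneg (hc i hi).2 (hω i hi).1.le
  have h3nonneg : 0 ≤ xiStar3 c' χ := Finset.sum_nonneg fun i hi =>
    mul_nonneg (mul_nonneg (hc i hi).2 (by positivity)) (hω i hi).1.le
  have h12nonneg : 0 ≤ xi12 c' χ := Finset.sum_nonneg fun i hi =>
    mul_nonneg (mul_nonneg (hc i hi).2 (by positivity)) (hω i hi).1.le
  have hprod : xi3sq c' χ * xi12 c' χ ≤ (ε₁ * X) * (K * X) :=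
    mul_le_mul hsq h12'' h12nonneg (mul_nonneg hε₁0.le hX0)
  have hKne : K ≠ 0 := hK0.ne'
  have hεX : (ε₁ * X) * (K * X) = (ε * X) ^ 2 := by rw [hε₁]; field_simp
  have hsq2 : xiStar3 c' χ ^ 2 ≤ (ε * X) ^ 2 := le_trans hcs (hεX ▸ hprod)
  have hfin : xiStar3 c' χ ≤ ε * X :=
    (pow_le_pow_iff_left₀ h3nonneg (mul_nonneg hε.le hX0) two_ne_zero).mp hsq2
  simpa [hX, mul_assoc] using hfin

/-- **`Z22:Prop2.6.pf`** — §11 as ONE deduction node ("Proof of Proposition 2.6", pp. 62–66): its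
cited inputs — the result of §9 ((9.7), `Skeleton.Eval97`), Lemma 11.1 (`Skeleton.Lemma111`),
Lemma 11.2 (`Skeleton.Lemma112`) and the mean-value bounds cited as "(8.25), (8.26)" (no such
displays in v1; read with the skeleton as `Skeleton.Lemma81` + `Skeleton.Prop71`) — imply Prop. 2.6
(`Skeleton.Prop26`). CLAIM (the manuscript's proof), stated; = the banked `Skeleton.Ded111` composed
with the Cauchy reduction (`sec11Ded_of`); the `g̃`-free form is `Sec11DedP` (module TYPING NOTE).
[Z22 p.62, tex L3189]
[cite: Zhang2022LandauSiegel, §11 p. 62] -/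
def Sec11Ded : Prop :=
  Eval97 c' → Lemma111 → Lemma112 → Lemma81 c' → Prop71 c' → Prop26 c'

/-- **Edge for `Z22:Prop2.6.pf`**: the §11 deduction node holds as soon as its inner computation
`Skeleton.Ded111` ((11.5)–(11.6) ⇒ (11.1)) does, given Prop. 2.2 (i), Lemma 2.3, `ψχ` primitive and
`𝔞 ≫ 1` (kernel: `Skeleton.eval111_of`, `Skeleton.prop26_of_evals`). [Z22 p.62, tex L3189]
[cite: Zhang2022LandauSiegel, §11 p. 62] -/
theorem sec11Ded_of (h22 : Prop22i) (h23 : Lemma23 c') (hprim : PsiChiPrimitive)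
    (ha : FrakALowerBound) (hded : Ded111 c') : Sec11Ded c' :=
  fun h97 h111 h112 h81 h71 =>
    prop26_of_evals h22 h23 hprim (eval111_of c' h111 h112 h81 h71 hded) h97 ha

end Head

/-! ## The objects of p. 62–63 and the tails claim (tex L3201–L3217) -/

section Objects

variable {D : ℕ} [NeZero D] (χ : DirichletCharacter ℂ D) (x : Chr D)

/-- **`Z22:§11.u004`, the case `μ = 2`** — "`J̃_μ(s,ψ) = Σ_n ψχ(n)g̃_μ(n)n^{−s}`, `μ = 1, 2`": the
series `J̃₂(s,ψ)` itself (the tree has `J̃₁(s,ψ) = Skeleton.Jtilde1` and the reflected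
`J̃₂(1−s,ψ̄) = Skeleton.Jtilde2Bar` of Lemma 11.2, but not `J̃₂(s,ψ)`, which §11 p. 64 uses in
"`ΣΣ𝔠*|J₂ − J̃₂|²ω = o(𝔞𝔓)`"); `g̃₂ = Skeleton.gtilde2` (module TYPING NOTE; explicitly parenthesised
twin: `JTilde2` over `gTilde2`). OBJECT. [Z22 p.63, tex L3209]
[cite: Zhang2022LandauSiegel, §11 p. 63] -/
def Jtilde2 (s : ℂ) : ℂ := ∑' n : ℕ, pc χ x n * (gtilde2 D n : ℂ) * (n : ℂ) ^ (-s)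

/-- **Tails claim, p. 63 tex L3216** (between `Z22:§11.u005` and Lemma 11.1; proposed DAG id
`Z22:§11.u005b`) — "By (5) and (5) [sic: malformed references], for `σ = 1/2`, the terms with
`n ≤ P^{0.5}η₋` or `n ≥ P^{0.504}η₊` in `J̃₁(s,ψ)` contribute `≪ ε`" (`ε = exp{−c𝓛¹⁰}`, §4 p. 20;
`J̃₁ = Skeleton.Jtilde1`, `η_± = Skeleton.etaPM D (±1)`): the sum of those terms is `O(ε)` in
absolute value, uniformly for `Re s = 1/2` and `ψ ∈ Ψ`. CLAIM, stated not asserted (over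
`Skeleton.gtilde1`; explicitly parenthesised twin `TailsClaimP`, module TYPING NOTE).
[Z22 p.63, tex L3216] [cite: Zhang2022LandauSiegel, §11 p. 63] -/
def TailsClaim : Prop :=
  ∃ c : ℝ, 0 < c ∧ ∃ C : ℝ, ForAllLarge fun D _ χ => AssumptionA D χ → ∀ x : Chr D, ∀ s : ℂ,
    s.re = 1 / 2 →
      ‖∑' n : ℕ, (if (n : ℝ) ≤ bigP D ^ (0.5 : ℝ) * etaPM D (-1) ∨
            bigP D ^ (0.504 : ℝ) * etaPM D 1 ≤ (n : ℝ)
          then pc χ x n * (gtilde1 D n : ℂ) * (n : ℂ) ^ (-s) else 0)‖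
        ≤ C * Real.exp (-c * ell D ^ 10)

end Objects

/-! ## Lemma 11.1 (p. 63): its two halves (11.2), (11.3), by reference to `Skeleton.Lemma111` -/

/-- **`Z22:§11.u006`** — the range of (11.2): "`y ∈ [P^{0.5}η₊, P^{0.502}η₋] ∪ [P^{0.502}η₊, P^{0.504}η₋]`"
(written exactly as inside `Skeleton.Lemma111`). OBJECT (predicate). [Z22 p.63, tex L3221–L3223]
[cite: Zhang2022LandauSiegel, §11 Lemma 11.1 p. 63] -/
def Range112 (D : ℕ) (y : ℝ) : Prop :=
  (bigP D ^ (0.5 : ℝ) * etaPM D 1 ≤ y ∧ y ≤ bigP D ^ (0.502 : ℝ) * etaPM D (-1)) ∨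
    (bigP D ^ (0.502 : ℝ) * etaPM D 1 ≤ y ∧ y ≤ bigP D ^ (0.504 : ℝ) * etaPM D (-1))

/-- **`Z22:§11.u007`** — the range of (11.3): "`y ∈ (P^{0.5}η₋, P^{0.5}η₊) ∪ (P^{0.502}η₋, P^{0.502}η₊)
∪ (P^{0.504}η₋, P^{0.504}η₊)`" (as inside `Skeleton.Lemma111`: some `a ∈ {0.5, 0.502, 0.504}` with
`P^aη₋ < y < P^aη₊`). OBJECT (predicate). [Z22 p.63, tex L3229–L3231]
[cite: Zhang2022LandauSiegel, §11 Lemma 11.1 p. 63] -/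
def Range113 (D : ℕ) (y : ℝ) : Prop :=
  ∃ a ∈ ({0.5, 0.502, 0.504} : Finset ℝ), bigP D ^ a * etaPM D (-1) < y ∧ y < bigP D ^ a * etaPM D 1

/-- **`Z22:(11.2)`** — first half of Lemma 11.1: on `Range112`,
"`f̃(log y/log P) − g̃₁(y) ≪ ε`" (`ε = exp{−c𝓛¹⁰}`). CLAIM; together with `Eq113` equivalent to the
banked `Skeleton.Lemma111` (`lemma111_iff`); explicitly parenthesised twin `Eq112P` (module TYPING
NOTE). [Z22 p.63, (11.2), tex L3225–L3227]
[cite: Zhang2022LandauSiegel, §11 (11.2) p. 63] -/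
def Eq112 : Prop :=
  ∃ c : ℝ, 0 < c ∧ ∃ C : ℝ, ForAllLarge fun D _ _ => ∀ y : ℝ, Range112 D y →
    |ftilde (Real.log y / Real.log (bigP D)) - gtilde1 D y| ≤ C * Real.exp (-c * ell D ^ 10)

/-- **`Z22:(11.3)`** — second half of Lemma 11.1: on `Range113`,
"`f̃(log y/log P) − g̃₁(y) ≪ 𝓛⁻¹⁰`". CLAIM (over `Skeleton.gtilde1`; twin `Eq113P`).
[Z22 p.63, (11.3), tex L3233–L3235]
[cite: Zhang2022LandauSiegel, §11 (11.3) p. 63] -/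
def Eq113 : Prop :=
  ∃ C : ℝ, ForAllLarge fun D _ _ => ∀ y : ℝ, Range113 D y →
    |ftilde (Real.log y / Real.log (bigP D)) - gtilde1 D y| ≤ C * (ell D ^ 10)⁻¹

/-- **`Z22:Lem11.1`, skeleton form**: `Skeleton.Lemma111` is exactly the conjunction of the two
halves `Eq112`, `Eq113` (one pair of constants serves both); the explicitly parenthesised twin is
`Lemma111P` (`lemma111P_iff`, DISCHARGED by `lemma111P_holds`).
[Z22 p.63, tex L3220–L3235] [cite: Zhang2022LandauSiegel, §11 Lemma 11.1 p. 63] -/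
theorem lemma111_iff : Lemma111 ↔ Eq112 ∧ Eq113 := by
  constructor
  · rintro ⟨c, hc, C, h⟩
    exact ⟨⟨c, hc, C, h.mono fun D _ χ _ _ hD y hy => (hD y).1 hy⟩,
      ⟨C, h.mono fun D _ χ _ _ hD y hy => (hD y).2 hy⟩⟩
  · rintro ⟨⟨c, hc, C₁, h₁⟩, ⟨C₂, h₂⟩⟩
    refine ⟨c, hc, max C₁ C₂, (h₁.and h₂).mono fun D _ χ _ _ hD y => ⟨fun hy => ?_, fun hy => ?_⟩⟩
    · exact le_trans (hD.1 y hy)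
        (mul_le_mul_of_nonneg_right (le_max_left _ _) (Real.exp_pos _).le)
    · exact le_trans (hD.2 y hy) (mul_le_mul_of_nonneg_right (le_max_right _ _) (by positivity))

/-! ## Proof of Lemma 11.1 (pp. 63–64): the displayed steps -/

/-- `𝓛 = log D > 0` for `D ≥ 2`. [folklore] -/
private theorem ell_pos {D : ℕ} (hD : 2 ≤ D) : 0 < ell D :=
  Real.log_pos (by exact_mod_cast (by omega : 1 < D))

/-- **`Z22:§11.u008`** — "Since `g(1/x) = (1/√π)∫_{−∞}^{−𝓛¹⁵ log x} exp(−t²)dt =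
(1/√π)∫_{𝓛¹⁵ log x}^{∞} exp(−t²)dt`" (both equalities; the page prints the exponent as `𝓛 log x`
[sic] — (4.1), which this sentence instantiates at `1/x`, has `𝓛¹⁵ log x`, and `g = Skeleton.gW` is
(4.1) with `Λ = 𝓛³⁰`). CLAIM; PROVED below (`gInvErf_holds`). Stated for `D ≥ 2`, `x > 0`.
[Z22 p.63, tex L3240–L3242] [cite: Zhang2022LandauSiegel, §11 p. 63] -/
def GInvErf : Prop :=
  ∀ D : ℕ, 2 ≤ D → ∀ x : ℝ, 0 < x →
    (gW D x⁻¹ =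
        (1 / Real.sqrt π) * ∫ t in Set.Iic (-(ell D ^ 15 * Real.log x)), Real.exp (-t ^ 2)) ∧
      ((1 / Real.sqrt π) * ∫ t in Set.Iic (-(ell D ^ 15 * Real.log x)), Real.exp (-t ^ 2)) =
        (1 / Real.sqrt π) * ∫ t in Set.Ioi (ell D ^ 15 * Real.log x), Real.exp (-t ^ 2)

/-- **`Z22:(11.4)`** — "`g(x) + g(1/x) = 1`" (for `x > 0`; `g = Skeleton.gW`, `D ≥ 2`). CLAIM;
PROVED below (`eq114_holds`, from the tree's `GaussWeight.gWeight_add_tail`).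
[Z22 p.63, (11.4), tex L3244–L3246] [cite: Zhang2022LandauSiegel, §11 (11.4) p. 63] -/
def Eq114 : Prop := ∀ D : ℕ, 2 ≤ D → ∀ x : ℝ, 0 < x → gW D x + gW D x⁻¹ = 1

/-- **(11.4) holds**: `g(1/x) = √(Λ/π)∫_{u > log x}e^{−Λu²}du = 1 − g(x)` (even Gaussian).
[Z22 p.63, (11.4)] [cite: Zhang2022LandauSiegel, §11 (11.4) p. 63] -/
theorem eq114_holds : Eq114 := by
  intro D hD x _
  have hΛ : 0 < ell D ^ 30 := pow_pos (ell_pos hD) 30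
  rw [gW, gW, GaussWeight.gWeight_eq_integral_Ioi (x := x⁻¹), Real.log_inv, neg_neg]
  exact GaussWeight.gWeight_add_tail hΛ x

/-- **`Z22:§11.u008` holds** ((4.1) at `1/x`, `log(1/x) = −log x`, `√(𝓛³⁰) = 𝓛¹⁵`; then `t ↦ −t`).
[Z22 p.63, tex L3240] [cite: Zhang2022LandauSiegel, §11 p. 63] -/
theorem gInvErf_holds : GInvErf := by
  intro D hD x _
  have hL : 0 < ell D := ell_pos hD
  have hΛ : 0 < ell D ^ 30 := pow_pos hL 30
  have hsq : Real.sqrt (ell D ^ 30) = ell D ^ 15 := by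
    rw [show ell D ^ 30 = (ell D ^ 15) ^ 2 by ring, Real.sqrt_sq (pow_pos hL 15).le]
  refine ⟨?_, ?_⟩
  · rw [gW, GaussWeight.gWeight_eq_erf_form hΛ, hsq, Real.log_inv, mul_neg]
  · congr 1
    have h := integral_comp_neg_Ioi (ell D ^ 15 * Real.log x) (fun t : ℝ => Real.exp (-t ^ 2))
    -- `h : ∫ t in Ioi a, exp (−(−t)²) = ∫ t in Iic (−a), exp (−t²)`
    simp only [neg_sq] at h
    exact h.symm

/-- **`Z22:§11.u009`** — "Write `u = log y / log P`". OBJECT. [Z22 p.63, tex L3248–L3250]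
[cite: Zhang2022LandauSiegel, §11 p. 63] -/
def uOf (D : ℕ) (y : ℝ) : ℝ := Real.log y / Real.log (bigP D)

/-- **Case A of the proof of (11.2)** (p. 63 L3252): "First assume `T^{0.502}η₊ ≤ y ≤ P^{0.503}`"
— read `P^{0.502}η₊ ≤ y ≤ P^{0.503}` [sic: `T` printed for `P`; cases A and B split the second
interval `[P^{0.502}η₊, P^{0.504}η₋]` of (11.2) at `P^{0.503}`]. OBJECT (predicate).
[Z22 p.63, tex L3252] [cite: Zhang2022LandauSiegel, §11 p. 63] -/
def CaseA (D : ℕ) (y : ℝ) : Prop :=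
  bigP D ^ (0.502 : ℝ) * etaPM D 1 ≤ y ∧ y ≤ bigP D ^ (0.503 : ℝ)

/-- **Case B of the proof of (11.2)** (p. 64 L3266): "Now assume `P^{0.503} ≤ y ≤ P^{0.504}η₋`".
OBJECT (predicate). [Z22 p.64, tex L3266] [cite: Zhang2022LandauSiegel, §11 p. 64] -/
def CaseB (D : ℕ) (y : ℝ) : Prop :=
  bigP D ^ (0.503 : ℝ) ≤ y ∧ y ≤ bigP D ^ (0.504 : ℝ) * etaPM D (-1)

/-- **`Z22:§11.u010`** — case A, "By (11.4), `∫_{0.502}^{2u−0.502} g(P^z/y)dz = u − 0.502`" (an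
exact identity: the interval is symmetric about `u` and `g(P^{z−u}) + g(P^{u−z}) = 1`). CLAIM.
[Z22 p.63, tex L3252–L3255] [cite: Zhang2022LandauSiegel, §11 p. 63] -/
def StepU010 : Prop :=
  ∀ D : ℕ, 2 ≤ D → ∀ y : ℝ, CaseA D y →
    ∫ z in (0.502 : ℝ)..(2 * uOf D y - 0.502), gW D (bigP D ^ z / y) = uOf D y - 0.502

/-- **`Z22:§11.u011`** — case A, "by (6.2) [sic; the property used is (4.2)],
`∫_{2u−0.502}^{0.504} g(P^z/y)dz = 1.006 − 2u + O(ε)`". CLAIM.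
[Z22 p.63, tex L3256–L3259] [cite: Zhang2022LandauSiegel, §11 p. 63] -/
def StepU011 : Prop :=
  ∃ c : ℝ, 0 < c ∧ ∃ C : ℝ, ForAllLarge fun D _ _ => ∀ y : ℝ, CaseA D y →
    |(∫ z in (2 * uOf D y - 0.502)..(0.504 : ℝ), gW D (bigP D ^ z / y)) - (1.006 - 2 * uOf D y)|
      ≤ C * Real.exp (-c * ell D ^ 10)

/-- **`Z22:§11.u012`** — case A, "by (6.3) [sic; the property used is (4.3)],
`∫_{0.5}^{0.502} g(P^z/y)dz ≪ ε`". CLAIM. [Z22 p.63, tex L3260–L3263]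
[cite: Zhang2022LandauSiegel, §11 p. 63] -/
def StepU012 : Prop :=
  ∃ c : ℝ, 0 < c ∧ ∃ C : ℝ, ForAllLarge fun D _ _ => ∀ y : ℝ, CaseA D y →
    |∫ z in (0.5 : ℝ)..0.502, gW D (bigP D ^ z / y)| ≤ C * Real.exp (-c * ell D ^ 10)

/-- **`Z22:§11.u013`** — case B, "By (11.4), `∫_{2u−0.504}^{0.504} g(P^z/y)dz = 0.504 − u`" (exact;
symmetric about `u`). CLAIM. [Z22 p.64, tex L3266–L3269] [cite: Zhang2022LandauSiegel, §11 p. 64] -/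
def StepU013 : Prop :=
  ∀ D : ℕ, 2 ≤ D → ∀ y : ℝ, CaseB D y →
    ∫ z in (2 * uOf D y - 0.504)..(0.504 : ℝ), gW D (bigP D ^ z / y) = 0.504 - uOf D y

/-- **`Z22:§11.u014` AS PRINTED** — case B, "by (6.2), `∫_{0.502}^{2u−0.504} g(P^z/y)dz = 2u − 1.006
+ O(ε)`". CLAIM, typed verbatim. Reading note (module docstring (e)): on this range `z ≤ 2u − 0.504
≤ u − 𝓛⁻¹⁹`, so `P^z/y ≤ η₋`-small and the integral is `O(ε)`; the corrected step is `StepU014corr`,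
and the printed conclusion "(11.2)" of case B follows from the corrected step, not from this one.
[Z22 p.64, tex L3270–L3273] [cite: Zhang2022LandauSiegel, §11 p. 64] -/
def StepU014 : Prop :=
  ∃ c : ℝ, 0 < c ∧ ∃ C : ℝ, ForAllLarge fun D _ _ => ∀ y : ℝ, CaseB D y →
    |(∫ z in (0.502 : ℝ)..(2 * uOf D y - 0.504), gW D (bigP D ^ z / y)) - (2 * uOf D y - 1.006)|
      ≤ C * Real.exp (-c * ell D ^ 10)

/-- **`Z22:§11.u014`, corrected reading** — case B: `∫_{0.502}^{2u−0.504} g(P^z/y)dz ≪ ε` (what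
(4.3) gives on this range and what the case-B assembly of (11.2) consumes:
`g̃₁(y) = 500(0.504 − u) + O(ε) = f̃(u) + O(ε)`). Typed ALONGSIDE the verbatim `StepU014`; recorded
for the campaign's GAP-LEDGER as a repairable misprint, not as a verdict. [Z22 p.64, tex L3270–L3273]
[cite: Zhang2022LandauSiegel, §11 p. 64] -/
def StepU014corr : Prop :=
  ∃ c : ℝ, 0 < c ∧ ∃ C : ℝ, ForAllLarge fun D _ _ => ∀ y : ℝ, CaseB D y →
    |∫ z in (0.502 : ℝ)..(2 * uOf D y - 0.504), gW D (bigP D ^ z / y)|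
      ≤ C * Real.exp (-c * ell D ^ 10)

/-- **`Z22:§11.u015`** — case B, "by (6.3), `∫_{0.5}^{0.502} g(P^z/y)dz ≪ ε`". CLAIM.
[Z22 p.64, tex L3274–L3277] [cite: Zhang2022LandauSiegel, §11 p. 64] -/
def StepU015 : Prop :=
  ∃ c : ℝ, 0 < c ∧ ∃ C : ℝ, ForAllLarge fun D _ _ => ∀ y : ℝ, CaseB D y →
    |∫ z in (0.5 : ℝ)..0.502, gW D (bigP D ^ z / y)| ≤ C * Real.exp (-c * ell D ^ 10)

/-- **The window treated in the proof of (11.3)** (p. 64 L3280): "`P^{0.502}η₋ < y < P^{0.502}η₊`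
only; the other cases are similar". OBJECT (predicate). [Z22 p.64, tex L3280]
[cite: Zhang2022LandauSiegel, §11 p. 64] -/
def Window0502 (D : ℕ) (y : ℝ) : Prop :=
  bigP D ^ (0.502 : ℝ) * etaPM D (-1) < y ∧ y < bigP D ^ (0.502 : ℝ) * etaPM D 1

/-- **`Z22:§11.u016` (first display)** — on `Window0502`, "`∫_{0.502}^{0.504} g(P^z/y)dz = 1/500
+ O(𝓛⁻¹⁰)`" ("by (5.2) and (5.3)" [sic; (4.2)–(4.3) and `0 < g < 1`]). CLAIM.
[Z22 p.64, tex L3281–L3284] [cite: Zhang2022LandauSiegel, §11 p. 64] -/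
def StepU016a : Prop :=
  ∃ C : ℝ, ForAllLarge fun D _ _ => ∀ y : ℝ, Window0502 D y →
    |(∫ z in (0.502 : ℝ)..0.504, gW D (bigP D ^ z / y)) - 1 / 500| ≤ C * (ell D ^ 10)⁻¹

/-- **`Z22:§11.u016` (second display)** — on `Window0502`, "`∫_{0.5}^{0.502} g(P^z/y)dz = O(𝓛⁻¹⁰)`".
CLAIM. [Z22 p.64, tex L3281–L3284] [cite: Zhang2022LandauSiegel, §11 p. 64] -/
def StepU016b : Prop :=
  ∃ C : ℝ, ForAllLarge fun D _ _ => ∀ y : ℝ, Window0502 D y →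
    |∫ z in (0.5 : ℝ)..0.502, gW D (bigP D ^ z / y)| ≤ C * (ell D ^ 10)⁻¹

/-- **`Z22:§11.u017`** — on `Window0502`, "`f̃(log y/log P) = 1 + O(𝓛⁻¹⁰)`" (`f̃ = Skeleton.ftilde`,
(2.28)). CLAIM. [Z22 p.64, tex L3286–L3288] [cite: Zhang2022LandauSiegel, §11 p. 64] -/
def StepU017 : Prop :=
  ∃ C : ℝ, ForAllLarge fun D _ _ => ∀ y : ℝ, Window0502 D y →
    |ftilde (Real.log y / Real.log (bigP D)) - 1| ≤ C * (ell D ^ 10)⁻¹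

/-- **`Z22:Lem11.1.pf`** — the printed proof of Lemma 11.1 as ONE implication from its displayed
steps to the banked statement `Skeleton.Lemma111`: (11.4); case A (`StepU010`–`StepU012`, "These
together imply (11.2)"); case B (`StepU013`, `StepU014corr`, `StepU015`; "The proof of (11.2) with
`y ∈ [P^{0.5}η₊, P^{0.502}η₋]` is similar"); the `P^{0.502}`-window of (11.3) (`StepU016a/b`,
`StepU017`; "the other cases are similar"). The "similar" cases have no printed displays and are part
of what discharging this node means. Uses the corrected `StepU014corr` (with the verbatim `StepU014`
the implication would hold vacuously — see the module docstring (e)). CLAIM (a proof), stated;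
twin with the explicitly parenthesised conclusion: `Lemma111DedP` (PROVED, `lemma111DedP_holds`).
[Z22 pp.63–64, tex L3238–L3288] [cite: Zhang2022LandauSiegel, §11 Lemma 11.1 proof pp. 63–64] -/
def Lemma111Ded : Prop :=
  Eq114 → StepU010 → StepU011 → StepU012 → StepU013 → StepU014corr → StepU015 →
    StepU016a → StepU016b → StepU017 → Lemma111

/-! ## v2: `g̃₁, g̃₂, J̃₁, J̃₂` with explicit parentheses, and the printed Lemma 11.1 over them

See the module TYPING NOTE: these coincide definitionally with the skeleton objects once the
skeleton's bodies carry the same parentheses. -/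

/-- **`Z22:§11.u002` — `g̃₁(y) = −500∫_{0.5}^{0.502} g(P^z/y)dz + 500∫_{0.502}^{0.504} g(P^z/y)dz`**
(p. 62), written with explicit parentheses (`g = Skeleton.gW`, `P = Skeleton.bigP`). OBJECT.
[Z22 p.62, tex L3202–L3204] [cite: Zhang2022LandauSiegel, §11 p. 62] -/
def gTilde1 (D : ℕ) (y : ℝ) : ℝ :=
  -500 * (∫ z in (0.5 : ℝ)..0.502, gW D (bigP D ^ z / y)) +
    500 * (∫ z in (0.502 : ℝ)..0.504, gW D (bigP D ^ z / y))

/-- **`Z22:§11.u003` — `g̃₂(y) = −500∫_{0.496}^{0.498} g(P^zDt₀/y)dz + 500∫_{0.498}^{0.5} g(P^zDt₀/y)dz`**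
(p. 62), written with explicit parentheses. OBJECT. [Z22 p.62, tex L3205–L3207]
[cite: Zhang2022LandauSiegel, §11 p. 62] -/
def gTilde2 (D : ℕ) (y : ℝ) : ℝ :=
  -500 * (∫ z in (0.496 : ℝ)..0.498, gW D (bigP D ^ z * D * t0 D / y)) +
    500 * (∫ z in (0.498 : ℝ)..0.5, gW D (bigP D ^ z * D * t0 D / y))

section ObjectsV2

variable {D : ℕ} [NeZero D] (χ : DirichletCharacter ℂ D) (x : Chr D)

/-- **`Z22:§11.u004`, `μ = 1` — `J̃₁(s,ψ) = Σ_n ψχ(n)g̃₁(n)n^{−s}`** over `gTilde1` (same shape as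
`Skeleton.Jtilde1`). OBJECT.
[Z22 p.63, tex L3209] [cite: Zhang2022LandauSiegel, §11 p. 63] -/
def JTilde1 (s : ℂ) : ℂ := ∑' n : ℕ, pc χ x n * (gTilde1 D n : ℂ) * (n : ℂ) ^ (-s)

/-- **`Z22:§11.u004`, `μ = 2` — `J̃₂(s,ψ) = Σ_n ψχ(n)g̃₂(n)n^{−s}`** over the printed `g̃₂ = gTilde2`.
OBJECT. [Z22 p.63, tex L3209] [cite: Zhang2022LandauSiegel, §11 p. 63] -/
def JTilde2 (s : ℂ) : ℂ := ∑' n : ℕ, pc χ x n * (gTilde2 D n : ℂ) * (n : ℂ) ^ (-s)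

/-- **`J̃₂(w,ψ̄) = Σ_n conj(ψχ(n)) g̃₂(n) n^{−w}`** (used at `w = 1 − s` in Lemma 11.2) over the printed
`g̃₂ = gTilde2` (same shape as the banked `Skeleton.Jtilde2Bar`). OBJECT.
[Z22 p.65, Lemma 11.2, tex L3319–L3321] [cite: Zhang2022LandauSiegel, §11 Lemma 11.2 p. 65] -/
def JTilde2Bar (w : ℂ) : ℂ := ∑' n : ℕ, conj (pc χ x n) * (gTilde2 D n : ℂ) * (n : ℂ) ^ (-w)

/-- **Tails claim, p. 63 tex L3216** (proposed `Z22:§11.u005b`), over the printed `g̃₁ = gTilde1`: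
"for `σ = 1/2`, the terms with `n ≤ P^{0.5}η₋` or `n ≥ P^{0.504}η₊` in `J̃₁(s,ψ)` contribute `≪ ε`"
("By (5) and (5)" [sic]). CLAIM, stated not asserted. [Z22 p.63, tex L3216]
[cite: Zhang2022LandauSiegel, §11 p. 63] -/
def TailsClaimP : Prop :=
  ∃ c : ℝ, 0 < c ∧ ∃ C : ℝ, ForAllLarge fun D _ χ => AssumptionA D χ → ∀ x : Chr D, ∀ s : ℂ,
    s.re = 1 / 2 →
      ‖∑' n : ℕ, (if (n : ℝ) ≤ bigP D ^ (0.5 : ℝ) * etaPM D (-1) ∨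
            bigP D ^ (0.504 : ℝ) * etaPM D 1 ≤ (n : ℝ)
          then pc χ x n * (gTilde1 D n : ℂ) * (n : ℂ) ^ (-s) else 0)‖
        ≤ C * Real.exp (-c * ell D ^ 10)

end ObjectsV2

/-- **`Z22:(11.2)`, printed** — on `Range112`, "`f̃(log y/log P) − g̃₁(y) ≪ ε`" with `g̃₁ = gTilde1`.
CLAIM. [Z22 p.63, (11.2), tex L3225–L3227] [cite: Zhang2022LandauSiegel, §11 (11.2) p. 63] -/
def Eq112P : Prop :=
  ∃ c : ℝ, 0 < c ∧ ∃ C : ℝ, ForAllLarge fun D _ _ => ∀ y : ℝ, Range112 D y →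
    |ftilde (Real.log y / Real.log (bigP D)) - gTilde1 D y| ≤ C * Real.exp (-c * ell D ^ 10)

/-- **`Z22:(11.3)`, printed** — on `Range113`, "`f̃(log y/log P) − g̃₁(y) ≪ 𝓛⁻¹⁰`" with
`g̃₁ = gTilde1`. CLAIM. [Z22 p.63, (11.3), tex L3233–L3235]
[cite: Zhang2022LandauSiegel, §11 (11.3) p. 63] -/
def Eq113P : Prop :=
  ∃ C : ℝ, ForAllLarge fun D _ _ => ∀ y : ℝ, Range113 D y →
    |ftilde (Real.log y / Real.log (bigP D)) - gTilde1 D y| ≤ C * (ell D ^ 10)⁻¹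

/-- **`Z22:Lem11.1` — Lemma 11.1 AS PRINTED** (p. 63): (11.2) on the two closed ranges and (11.3) on
the three windows, for `g̃₁ = gTilde1` — the shape of `Skeleton.Lemma111` with the explicitly
parenthesised weight (no Assumption (A): pure real analysis; the skeleton owner's (A)-qualified
reading wraps this body). CLAIM, stated not asserted — and PROVED below (`lemma111P_holds`).
[Z22 p.63, Lemma 11.1, tex L3220–L3235] [cite: Zhang2022LandauSiegel, §11 Lemma 11.1 p. 63] -/
def Lemma111P : Prop :=
  ∃ c : ℝ, 0 < c ∧ ∃ C : ℝ, ForAllLarge fun D _ _ => ∀ y : ℝ,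
    (Range112 D y →
      |ftilde (Real.log y / Real.log (bigP D)) - gTilde1 D y| ≤ C * Real.exp (-c * ell D ^ 10)) ∧
    (Range113 D y →
      |ftilde (Real.log y / Real.log (bigP D)) - gTilde1 D y| ≤ C * (ell D ^ 10)⁻¹)

/-- `Lemma111P` is exactly the conjunction of its printed halves `Eq112P`, `Eq113P`.
[Z22 p.63, tex L3220–L3235] [cite: Zhang2022LandauSiegel, §11 Lemma 11.1 p. 63] -/
theorem lemma111P_iff : Lemma111P ↔ Eq112P ∧ Eq113P := by
  constructor
  · rintro ⟨c, hc, C, h⟩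
    exact ⟨⟨c, hc, C, h.mono fun D _ χ _ _ hD y hy => (hD y).1 hy⟩,
      ⟨C, h.mono fun D _ χ _ _ hD y hy => (hD y).2 hy⟩⟩
  · rintro ⟨⟨c, hc, C₁, h₁⟩, ⟨C₂, h₂⟩⟩
    refine ⟨c, hc, max C₁ C₂, (h₁.and h₂).mono fun D _ χ _ _ hD y => ⟨fun hy => ?_, fun hy => ?_⟩⟩
    · exact le_trans (hD.1 y hy)
        (mul_le_mul_of_nonneg_right (le_max_left _ _) (Real.exp_pos _).le)
    · exact le_trans (hD.2 y hy) (mul_le_mul_of_nonneg_right (le_max_right _ _) (by positivity))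

/-- **`Z22:Lem11.1.pf`, printed conclusion** — the displayed steps of the proof (all about `g`, hence
unaffected by the parenthesisation) imply Lemma 11.1 AS PRINTED, `Lemma111P`. CLAIM (a proof).
[Z22 pp.63–64, tex L3238–L3288] [cite: Zhang2022LandauSiegel, §11 Lemma 11.1 proof pp. 63–64] -/
def Lemma111DedP : Prop :=
  Eq114 → StepU010 → StepU011 → StepU012 → StepU013 → StepU014corr → StepU015 →
    StepU016a → StepU016b → StepU017 → Lemma111P

section HeadV2

variable (c' : ℝ)

/-- **`Z22:Prop2.6.pf`, robust form** — §11's deduction with its §11b part collapsed to its output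
(11.1): the result of §9 ((9.7), `Skeleton.Eval97`) and (11.1) (`Skeleton.Eval111`) imply
Proposition 2.6 (`Skeleton.Prop26`). Independent of the `g̃` objects; PROVED from the standing
positivity inputs in `sec11DedP_of`. CLAIM (the manuscript's proof), stated.
[Z22 p.62, tex L3189–L3199] [cite: Zhang2022LandauSiegel, §11 p. 62] -/
def Sec11DedP : Prop := Eval97 c' → Eval111 c' → Prop26 c'

/-- **Edge**: `Sec11DedP` holds given Prop. 2.2 (i), Lemma 2.3, `ψχ` primitive and `𝔞 ≫ 1`
(`xi12Bound_of_eval97` + `cauchyReduction_of`). [Z22 p.62, tex L3189–L3199]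
[cite: Zhang2022LandauSiegel, §11 p. 62] -/
theorem sec11DedP_of (h22 : Prop22i) (h23 : Lemma23 c') (hprim : PsiChiPrimitive)
    (ha : FrakALowerBound) : Sec11DedP c' :=
  fun h97 h111 => cauchyReduction_of c' h22 h23 hprim (xi12Bound_of_eval97 c' h97 ha) h111

end HeadV2

/-! ## Discharge: Lemma 11.1 as printed HOLDS (`lemma111P_holds`)

The printed proof of pp. 63–64, with the tree's (4.2)–(4.3) (`GaussWeight.abs_gWeight_sub_one_le`,
`GaussWeight.gWeight_le`), `0 < g < 1` and monotonicity of `g` (`GaussWeight.gWeight_pos/lt_one/mono`),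
(11.4) (`eq114_holds`), the corrected case-B step, and the "similar" cases carried out. On the
`u`-scale (`u = log y/log P`, `P^z/y = P^{z−u}`): `|g(P^{z−u}) − 1|` resp. `|g(P^{z−u})|` is
`≤ ½e^{−𝓛¹⁰}` once `z − u ≥ 𝓛⁻¹⁹` resp. `≤ −𝓛⁻¹⁹` (`𝓛³⁰·((z−u)𝓛⁹)² ≥ 𝓛¹⁰`), and
`∫_{u−h}^{u+h} g(P^{z−u})dz = h` exactly. Constants: `c = 1`, `C = 4000`, `D ≥ 9`. -/

section Discharge

variable {D : ℕ} {y : ℝ}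

/-- `log D ≥ 2` for `D ≥ 9` (`e² < 9`). [folklore] -/
private theorem two_le_ell (hD : 9 ≤ D) : 2 ≤ ell D := by
  have h9 : (9 : ℝ) ≤ D := by exact_mod_cast hD
  have he : Real.exp 2 ≤ 9 := by
    have h1 := Real.exp_one_lt_d9
    have h2 : Real.exp 2 = Real.exp 1 * Real.exp 1 := by rw [← Real.exp_add]; norm_num
    rw [h2]; nlinarith [Real.exp_pos 1]
  calc (2 : ℝ) = Real.log (Real.exp 2) := (Real.log_exp 2).symm
    _ ≤ Real.log 9 := Real.log_le_log (Real.exp_pos _) he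
    _ ≤ Real.log D := Real.log_le_log (by norm_num) h9

/-- `0 < g` for the file's `g = Skeleton.gW` (`𝓛 > 0`). [cite: Zhang2022LandauSiegel, §4 (4.1)] -/
private theorem gW_pos (hL : 0 < ell D) (x : ℝ) : 0 < gW D x :=
  GaussWeight.gWeight_pos (pow_pos hL 30) x

/-- `g < 1`. [cite: Zhang2022LandauSiegel, §4 (4.1)] -/
private theorem gW_lt_one (hL : 0 < ell D) (x : ℝ) : gW D x < 1 :=
  GaussWeight.gWeight_lt_one (pow_pos hL 30) x

/-- `z ↦ g(P^z/y)` is monotone (`P ≥ 1`, `y > 0`, `g` increasing). [cite: Zhang2022LandauSiegel, §4 (4.1)] -/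
private theorem g_mono (hL : 0 < ell D) (hy : 0 < y) :
    Monotone fun z : ℝ => gW D (bigP D ^ z / y) := by
  intro z₁ z₂ h
  have hP1 : 1 ≤ bigP D := Real.one_le_exp (pow_nonneg hL.le 9)
  have hP0 : 0 < bigP D := Real.exp_pos _
  exact GaussWeight.gWeight_mono (pow_pos hL 30) (div_pos (Real.rpow_pos_of_pos hP0 z₁) hy)
    (div_le_div_of_nonneg_right (Real.rpow_le_rpow_of_exponent_le hP1 h) hy.le)

/-- `log(P^z/y) = (z − u)𝓛⁹`, `u = log y/log P`. [cite: Zhang2022LandauSiegel, §11 p. 63] -/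
private theorem log_arg (hL : 0 < ell D) (hy : 0 < y) (z : ℝ) :
    Real.log (bigP D ^ z / y) = (z - uOf D y) * ell D ^ 9 := by
  have hP : 0 < bigP D := Real.exp_pos _
  rw [Real.log_div (Real.rpow_pos_of_pos hP z).ne' hy.ne', Real.log_rpow hP, uOf, bigP, Real.log_exp]
  have h9 : ell D ^ 9 ≠ 0 := pow_ne_zero _ hL.ne'
  field_simp

/-- `log(P^a·η_s) = (a + s𝓛⁻¹⁹)𝓛⁹` (`η_s = exp{s𝓛⁻¹⁰}`). [cite: Zhang2022LandauSiegel, §11 p. 63] -/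
private theorem log_Pa_eta (hL : 0 < ell D) (a s : ℝ) :
    Real.log (bigP D ^ a * etaPM D s) = (a + s * (ell D ^ 19)⁻¹) * ell D ^ 9 := by
  have hP : 0 < bigP D := Real.exp_pos _
  rw [etaPM, Real.log_mul (Real.rpow_pos_of_pos hP a).ne' (Real.exp_pos _).ne', Real.log_rpow hP,
    Real.log_exp, bigP, Real.log_exp]
  have h19 : ell D ^ 19 ≠ 0 := pow_ne_zero _ hL.ne'
  field_simp

/-- `P^aη_s ≤ y ⇒ a + s𝓛⁻¹⁹ ≤ u`. [cite: Zhang2022LandauSiegel, §11 p. 63] -/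
private theorem u_lower (hL : 0 < ell D) {a s : ℝ} (h : bigP D ^ a * etaPM D s ≤ y) :
    a + s * (ell D ^ 19)⁻¹ ≤ uOf D y := by
  have hpos : 0 < bigP D ^ a * etaPM D s :=
    mul_pos (Real.rpow_pos_of_pos (Real.exp_pos _) a) (Real.exp_pos _)
  have h1 := Real.log_le_log hpos h
  rw [log_Pa_eta hL] at h1
  rw [uOf, bigP, Real.log_exp, le_div_iff₀ (pow_pos hL 9)]
  exact h1

/-- `y ≤ P^aη_s ⇒ u ≤ a + s𝓛⁻¹⁹` (`y > 0`). [cite: Zhang2022LandauSiegel, §11 p. 63] -/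
private theorem u_upper (hL : 0 < ell D) (hy : 0 < y) {a s : ℝ} (h : y ≤ bigP D ^ a * etaPM D s) :
    uOf D y ≤ a + s * (ell D ^ 19)⁻¹ := by
  have h1 := Real.log_le_log hy h
  rw [log_Pa_eta hL] at h1
  rw [uOf, bigP, Real.log_exp, div_le_iff₀ (pow_pos hL 9)]
  exact h1

/-- `P^aη_s < y ⇒ a + s𝓛⁻¹⁹ < u`. [cite: Zhang2022LandauSiegel, §11 p. 63] -/
private theorem u_lower_lt (hL : 0 < ell D) {a s : ℝ} (h : bigP D ^ a * etaPM D s < y) :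
    a + s * (ell D ^ 19)⁻¹ < uOf D y := by
  have hpos : 0 < bigP D ^ a * etaPM D s :=
    mul_pos (Real.rpow_pos_of_pos (Real.exp_pos _) a) (Real.exp_pos _)
  have h1 := Real.log_lt_log hpos h
  rw [log_Pa_eta hL] at h1
  rw [uOf, bigP, Real.log_exp, lt_div_iff₀ (pow_pos hL 9)]
  exact h1

/-- `y < P^aη_s ⇒ u < a + s𝓛⁻¹⁹` (`y > 0`). [cite: Zhang2022LandauSiegel, §11 p. 63] -/
private theorem u_upper_lt (hL : 0 < ell D) (hy : 0 < y) {a s : ℝ} (h : y < bigP D ^ a * etaPM D s) :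
    uOf D y < a + s * (ell D ^ 19)⁻¹ := by
  have h1 := Real.log_lt_log hy h
  rw [log_Pa_eta hL] at h1
  rw [uOf, bigP, Real.log_exp, div_lt_iff₀ (pow_pos hL 9)]
  exact h1

/-- The exponent comparison `𝓛¹⁰ ≤ 𝓛³⁰((z−u)𝓛⁹)²` once `(z−u)² ≥ 𝓛⁻³⁸`. [folklore] -/
private theorem exponent_le (hL : 0 < ell D) {w : ℝ} (hw : ((ell D ^ 19)⁻¹) ^ 2 ≤ w ^ 2) :
    ell D ^ 10 ≤ ell D ^ 30 * (w * ell D ^ 9) ^ 2 := by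
  have h19 : ell D ^ 19 ≠ 0 := pow_ne_zero _ hL.ne'
  calc ell D ^ 10 = ell D ^ 30 * ((ell D ^ 19)⁻¹ * ell D ^ 9) ^ 2 := by field_simp
    _ ≤ ell D ^ 30 * (w * ell D ^ 9) ^ 2 := by
        apply mul_le_mul_of_nonneg_left _ (pow_pos hL 30).le
        rw [mul_pow, mul_pow]
        exact mul_le_mul_of_nonneg_right hw (by positivity)

/-- **(4.2) on the `u`-scale**: `z − u ≥ 𝓛⁻¹⁹ ⇒ |g(P^z/y) − 1| ≤ ½e^{−𝓛¹⁰}`.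
[cite: Zhang2022LandauSiegel, §4 (4.2)] -/
private theorem g_near_one (hL : 0 < ell D) (hy : 0 < y) {z : ℝ}
    (hz : (ell D ^ 19)⁻¹ ≤ z - uOf D y) :
    |gW D (bigP D ^ z / y) - 1| ≤ 1 / 2 * Real.exp (-ell D ^ 10) := by
  have hΛ : 0 < ell D ^ 30 := pow_pos hL 30
  have hx0 : 0 < bigP D ^ z / y := div_pos (Real.rpow_pos_of_pos (Real.exp_pos _) z) hy
  have hlog := log_arg hL hy z
  have hη : 0 < (ell D ^ 19)⁻¹ := inv_pos.mpr (pow_pos hL 19)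
  have hzu : 0 ≤ z - uOf D y := le_trans hη.le hz
  have hx1 : 1 ≤ bigP D ^ z / y := by
    rw [← Real.log_nonneg_iff hx0, hlog]; positivity
  rw [gW]
  refine le_trans (GaussWeight.abs_gWeight_sub_one_le hΛ hx1)
    (mul_le_mul_of_nonneg_left (Real.exp_le_exp.mpr ?_) (by norm_num))
  rw [hlog, neg_mul, neg_le_neg_iff]
  exact exponent_le hL (pow_le_pow_left₀ hη.le hz 2)

/-- **(4.3) on the `u`-scale**: `z − u ≤ −𝓛⁻¹⁹ ⇒ |g(P^z/y)| ≤ ½e^{−𝓛¹⁰}`.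
[cite: Zhang2022LandauSiegel, §4 (4.3)] -/
private theorem g_small (hL : 0 < ell D) (hy : 0 < y) {z : ℝ}
    (hz : z - uOf D y ≤ -(ell D ^ 19)⁻¹) :
    |gW D (bigP D ^ z / y)| ≤ 1 / 2 * Real.exp (-ell D ^ 10) := by
  have hΛ : 0 < ell D ^ 30 := pow_pos hL 30
  have hx0 : 0 < bigP D ^ z / y := div_pos (Real.rpow_pos_of_pos (Real.exp_pos _) z) hy
  have hlog := log_arg hL hy z
  have hη : 0 < (ell D ^ 19)⁻¹ := inv_pos.mpr (pow_pos hL 19)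
  have hzu : z - uOf D y ≤ 0 := by linarith
  have hx1 : bigP D ^ z / y ≤ 1 := by
    rw [← Real.log_nonpos_iff hx0.le, hlog]
    exact mul_nonpos_of_nonpos_of_nonneg hzu (pow_pos hL 9).le
  rw [abs_of_pos (gW_pos hL _), gW]
  refine le_trans (GaussWeight.gWeight_le hΛ hx0 hx1)
    (mul_le_mul_of_nonneg_left (Real.exp_le_exp.mpr ?_) (by norm_num))
  rw [hlog, neg_mul, neg_le_neg_iff]
  have h2 : ((ell D ^ 19)⁻¹) ^ 2 ≤ (z - uOf D y) ^ 2 := by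
    rw [← neg_sq (z - uOf D y)]
    exact pow_le_pow_left₀ hη.le (by linarith) 2
  exact exponent_le hL h2

/-- The integrand is interval-integrable on every interval (monotone). [folklore] -/
private theorem g_intervalIntegrable (hL : 0 < ell D) (hy : 0 < y) (a b : ℝ) :
    IntervalIntegrable (fun z : ℝ => gW D (bigP D ^ z / y)) volume a b :=
  (g_mono hL hy).intervalIntegrable

/-- **Tail piece**: `b ≤ u − 𝓛⁻¹⁹ ⇒ |∫_a^b g(P^z/y)dz| ≤ ½e^{−𝓛¹⁰}(b − a)` (`a ≤ b`).
[cite: Zhang2022LandauSiegel, §11 p. 63] -/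
private theorem int_small (hL : 0 < ell D) (hy : 0 < y) {a b : ℝ} (hab : a ≤ b)
    (hb : b ≤ uOf D y - (ell D ^ 19)⁻¹) :
    |∫ z in a..b, gW D (bigP D ^ z / y)| ≤ 1 / 2 * Real.exp (-ell D ^ 10) * (b - a) := by
  have key : ∀ z ∈ Set.uIoc a b, ‖gW D (bigP D ^ z / y)‖ ≤ 1 / 2 * Real.exp (-ell D ^ 10) := by
    intro z hz
    rw [Set.uIoc_of_le hab] at hz
    rw [Real.norm_eq_abs]
    exact g_small hL hy (by linarith [hz.2])
  have h := intervalIntegral.norm_integral_le_of_norm_le_const key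
  rw [Real.norm_eq_abs, abs_of_nonneg (sub_nonneg.mpr hab)] at h
  exact h

/-- **Plateau piece**: `u + 𝓛⁻¹⁹ ≤ a ≤ b ⇒ |∫_a^b g(P^z/y)dz − (b − a)| ≤ ½e^{−𝓛¹⁰}(b − a)`.
[cite: Zhang2022LandauSiegel, §11 p. 63] -/
private theorem int_near_len (hL : 0 < ell D) (hy : 0 < y) {a b : ℝ} (hab : a ≤ b)
    (ha : uOf D y + (ell D ^ 19)⁻¹ ≤ a) :
    |(∫ z in a..b, gW D (bigP D ^ z / y)) - (b - a)| ≤ 1 / 2 * Real.exp (-ell D ^ 10) * (b - a) := by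
  have hint := g_intervalIntegrable hL hy a b
  have h1 : (∫ z in a..b, gW D (bigP D ^ z / y)) - (b - a) =
      ∫ z in a..b, (gW D (bigP D ^ z / y) - 1) := by
    rw [intervalIntegral.integral_sub hint intervalIntegrable_const, intervalIntegral.integral_const,
      smul_eq_mul, mul_one]
  rw [h1]
  have key : ∀ z ∈ Set.uIoc a b, ‖gW D (bigP D ^ z / y) - 1‖ ≤ 1 / 2 * Real.exp (-ell D ^ 10) := by
    intro z hz
    rw [Set.uIoc_of_le hab] at hz
    rw [Real.norm_eq_abs]
    exact g_near_one hL hy (by linarith [hz.1])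
  have h := intervalIntegral.norm_integral_le_of_norm_le_const key
  rw [Real.norm_eq_abs, abs_of_nonneg (sub_nonneg.mpr hab)] at h
  exact h

/-- **Sliver**: `a ≤ b ⇒ 0 ≤ ∫_a^b g(P^z/y)dz ≤ b − a` (`0 < g < 1`). [cite: Zhang2022LandauSiegel, §4 (4.1)] -/
private theorem int_sliver (hL : 0 < ell D) (y : ℝ) {a b : ℝ} (hab : a ≤ b) :
    0 ≤ ∫ z in a..b, gW D (bigP D ^ z / y) ∧ ∫ z in a..b, gW D (bigP D ^ z / y) ≤ b - a := by
  refine ⟨intervalIntegral.integral_nonneg hab fun z _ => (gW_pos hL _).le, ?_⟩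
  have key : ∀ z ∈ Set.uIoc a b, ‖gW D (bigP D ^ z / y)‖ ≤ 1 := fun z _ => by
    rw [Real.norm_eq_abs, abs_of_pos (gW_pos hL _)]
    exact (gW_lt_one hL _).le
  have h := intervalIntegral.norm_integral_le_of_norm_le_const key
  rw [Real.norm_eq_abs, abs_of_nonneg (sub_nonneg.mpr hab), one_mul] at h
  exact (abs_le.mp h).2

/-- **The symmetric identity behind `StepU010`/`StepU013`**: `∫_{u−h}^{u+h} g(P^z/y)dz = h`
(`P^z/y = P^{z−u}` and `g(x) + g(1/x) = 1`). [cite: Zhang2022LandauSiegel, §11 (11.4) p. 63] -/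
private theorem int_symm (hD : 2 ≤ D) (hy : 0 < y) (h : ℝ) :
    ∫ z in (uOf D y - h)..(uOf D y + h), gW D (bigP D ^ z / y) = h := by
  have hL : 0 < ell D := ell_pos hD
  have hP : 0 < bigP D := Real.exp_pos _
  have hPu : bigP D ^ uOf D y = y := by
    rw [Real.rpow_def_of_pos hP, uOf, bigP, Real.log_exp,
      mul_div_cancel₀ _ (pow_ne_zero 9 hL.ne'), Real.exp_log hy]
  have hint : ∀ z : ℝ, gW D (bigP D ^ z / y) = (fun w : ℝ => gW D (bigP D ^ w)) (z - uOf D y) := by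
    intro z
    simp only
    rw [Real.rpow_sub hP, hPu]
  simp_rw [hint]
  rw [intervalIntegral.integral_comp_sub_right (fun w : ℝ => gW D (bigP D ^ w)) (uOf D y)]
  have e1 : uOf D y - h - uOf D y = -h := by ring
  have e2 : uOf D y + h - uOf D y = h := by ring
  rw [e1, e2]
  have hmono : Monotone fun w : ℝ => gW D (bigP D ^ w) := by
    intro w₁ w₂ hw
    have hP1 : 1 ≤ bigP D := Real.one_le_exp (pow_nonneg hL.le 9)
    exact GaussWeight.gWeight_mono (pow_pos hL 30) (Real.rpow_pos_of_pos hP w₁)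
      (Real.rpow_le_rpow_of_exponent_le hP1 hw)
  have hanti : Antitone fun w : ℝ => gW D (bigP D ^ (-w)) :=
    fun w₁ w₂ hw => hmono (neg_le_neg hw)
  have hsum : ∀ w : ℝ, gW D (bigP D ^ (-w)) + gW D (bigP D ^ w) = 1 := by
    intro w
    rw [Real.rpow_neg hP.le, add_comm]
    exact eq114_holds D hD (bigP D ^ w) (Real.rpow_pos_of_pos hP w)
  calc ∫ w in (-h)..h, gW D (bigP D ^ w)
      = (∫ w in (-h)..0, gW D (bigP D ^ w)) + ∫ w in (0 : ℝ)..h, gW D (bigP D ^ w) :=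
        (intervalIntegral.integral_add_adjacent_intervals hmono.intervalIntegrable
          hmono.intervalIntegrable).symm
    _ = (∫ w in (0 : ℝ)..h, gW D (bigP D ^ (-w))) + ∫ w in (0 : ℝ)..h, gW D (bigP D ^ w) := by
        rw [intervalIntegral.integral_comp_neg (fun w : ℝ => gW D (bigP D ^ w)), neg_zero]
    _ = ∫ w in (0 : ℝ)..h, (gW D (bigP D ^ (-w)) + gW D (bigP D ^ w)) :=
        (intervalIntegral.integral_add hanti.intervalIntegrable hmono.intervalIntegrable).symm
    _ = ∫ w in (0 : ℝ)..h, (1 : ℝ) := intervalIntegral.integral_congr fun w _ => hsum w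
    _ = h := by simp

/-- Splitting `∫_a^c = ∫_a^b + ∫_b^c` for the integrand `g(P^z/y)`. [folklore] -/
private theorem int_split (hL : 0 < ell D) (hy : 0 < y) (a b c : ℝ) :
    ∫ z in a..c, gW D (bigP D ^ z / y) =
      (∫ z in a..b, gW D (bigP D ^ z / y)) + ∫ z in b..c, gW D (bigP D ^ z / y) :=
  (intervalIntegral.integral_add_adjacent_intervals (g_intervalIntegrable hL hy a b)
    (g_intervalIntegrable hL hy b c)).symm

/-- **(11.2) on `[P^{0.502}η₊, P^{0.504}η₋]`** (cases A and B of the printed proof, p. 63–64, case B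
with the corrected step): `|f̃(u) − g̃₁(y)| ≤ e^{−𝓛¹⁰}`. [cite: Zhang2022LandauSiegel, §11 (11.2) p. 63] -/
private theorem part112_hi (hD : 9 ≤ D) (hy : 0 < y)
    (hu1 : 0.502 + (ell D ^ 19)⁻¹ ≤ uOf D y) (hu2 : uOf D y ≤ 0.504 - (ell D ^ 19)⁻¹) :
    |ftilde (uOf D y) - gTilde1 D y| ≤ Real.exp (-ell D ^ 10) := by
  have hL2 := two_le_ell hD
  have hL : 0 < ell D := by linarith
  have hD2 : 2 ≤ D := le_trans (by norm_num) hD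
  have hη0 : 0 < (ell D ^ 19)⁻¹ := by positivity
  have hE0 : 0 ≤ 1 / 2 * Real.exp (-ell D ^ 10) := by positivity
  -- `I₁ ≪ ε`
  have hI1 := int_small hL hy (a := 0.5) (b := 0.502) (by norm_num) (by linarith)
  -- `I₂ = 0.504 − u + O(ε)`
  have hI2 : |(∫ z in (0.502 : ℝ)..0.504, gW D (bigP D ^ z / y)) - (0.504 - uOf D y)|
      ≤ 1 / 2 * Real.exp (-ell D ^ 10) * 0.002 := by
    rcases le_total (uOf D y) 0.503 with hu3 | hu3
    · -- case A: split at `2u − 0.502`; `∫_{0.502}^{2u−0.502} = u − 0.502` (StepU010), rest ≈ its length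
      rw [int_split hL hy 0.502 (2 * uOf D y - 0.502) 0.504]
      have hS := int_symm hD2 hy (uOf D y - 0.502)
      rw [show uOf D y - (uOf D y - 0.502) = 0.502 by ring,
        show uOf D y + (uOf D y - 0.502) = 2 * uOf D y - 0.502 by ring] at hS
      rw [hS]
      have hT := int_near_len hL hy (a := 2 * uOf D y - 0.502) (b := 0.504) (by linarith) (by linarith)
      have hlen : (0.504 : ℝ) - (2 * uOf D y - 0.502) ≤ 0.002 := by linarith
      calc |uOf D y - 0.502 + (∫ z in (2 * uOf D y - 0.502)..(0.504 : ℝ), gW D (bigP D ^ z / y)) -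
              (0.504 - uOf D y)|
          = |(∫ z in (2 * uOf D y - 0.502)..(0.504 : ℝ), gW D (bigP D ^ z / y)) -
              (0.504 - (2 * uOf D y - 0.502))| := by congr 1; ring
        _ ≤ 1 / 2 * Real.exp (-ell D ^ 10) * (0.504 - (2 * uOf D y - 0.502)) := hT
        _ ≤ 1 / 2 * Real.exp (-ell D ^ 10) * 0.002 := mul_le_mul_of_nonneg_left hlen hE0
    · -- case B: split at `2u − 0.504`; first piece ≪ ε (StepU014corr), `∫_{2u−0.504}^{0.504} = 0.504 − u`
      rw [int_split hL hy 0.502 (2 * uOf D y - 0.504) 0.504]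
      have hS := int_symm hD2 hy (0.504 - uOf D y)
      rw [show uOf D y - (0.504 - uOf D y) = 2 * uOf D y - 0.504 by ring,
        show uOf D y + (0.504 - uOf D y) = 0.504 by ring] at hS
      rw [hS]
      have hT := int_small hL hy (a := 0.502) (b := 2 * uOf D y - 0.504) (by linarith) (by linarith)
      have hlen : 2 * uOf D y - 0.504 - 0.502 ≤ (0.002 : ℝ) := by linarith
      calc |(∫ z in (0.502 : ℝ)..(2 * uOf D y - 0.504), gW D (bigP D ^ z / y)) + (0.504 - uOf D y) -
              (0.504 - uOf D y)|
          = |∫ z in (0.502 : ℝ)..(2 * uOf D y - 0.504), gW D (bigP D ^ z / y)| := by congr 1; ring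
        _ ≤ 1 / 2 * Real.exp (-ell D ^ 10) * (2 * uOf D y - 0.504 - 0.502) := hT
        _ ≤ 1 / 2 * Real.exp (-ell D ^ 10) * 0.002 := mul_le_mul_of_nonneg_left hlen hE0
  -- assemble: `f̃(u) = 500(0.504 − u)`
  obtain ⟨a1, b1⟩ := abs_le.mp hI1
  obtain ⟨a2, b2⟩ := abs_le.mp hI2
  rw [gTilde1, ftilde]
  split_ifs with h1 h2
  · exfalso; linarith [h1.2]
  · rw [abs_le]; constructor <;> linarith
  · exfalso; exact h2 ⟨by linarith, by linarith⟩

/-- **(11.2) on `[P^{0.5}η₊, P^{0.502}η₋]`** ("similar", p. 64): `|f̃(u) − g̃₁(y)| ≤ e^{−𝓛¹⁰}`.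
[cite: Zhang2022LandauSiegel, §11 (11.2) p. 64] -/
private theorem part112_lo (hD : 9 ≤ D) (hy : 0 < y)
    (hu1 : 0.5 + (ell D ^ 19)⁻¹ ≤ uOf D y) (hu2 : uOf D y ≤ 0.502 - (ell D ^ 19)⁻¹) :
    |ftilde (uOf D y) - gTilde1 D y| ≤ Real.exp (-ell D ^ 10) := by
  have hL2 := two_le_ell hD
  have hL : 0 < ell D := by linarith
  have hD2 : 2 ≤ D := le_trans (by norm_num) hD
  have hη0 : 0 < (ell D ^ 19)⁻¹ := by positivity
  have hE0 : 0 ≤ 1 / 2 * Real.exp (-ell D ^ 10) := by positivity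
  -- `I₂ = 0.002 + O(ε)`
  have hI2 := int_near_len hL hy (a := 0.502) (b := 0.504) (by norm_num) (by linarith)
  -- `I₁ = 0.502 − u + O(ε)`
  have hI1 : |(∫ z in (0.5 : ℝ)..0.502, gW D (bigP D ^ z / y)) - (0.502 - uOf D y)|
      ≤ 1 / 2 * Real.exp (-ell D ^ 10) * 0.002 := by
    rcases le_total (uOf D y) 0.501 with hu3 | hu3
    · -- split at `2u − 0.5`: symmetric piece `= u − 0.5`, then a plateau piece
      rw [int_split hL hy 0.5 (2 * uOf D y - 0.5) 0.502]
      have hS := int_symm hD2 hy (uOf D y - 0.5)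
      rw [show uOf D y - (uOf D y - 0.5) = 0.5 by ring,
        show uOf D y + (uOf D y - 0.5) = 2 * uOf D y - 0.5 by ring] at hS
      rw [hS]
      have hT := int_near_len hL hy (a := 2 * uOf D y - 0.5) (b := 0.502) (by linarith) (by linarith)
      have hlen : (0.502 : ℝ) - (2 * uOf D y - 0.5) ≤ 0.002 := by linarith
      calc |uOf D y - 0.5 + (∫ z in (2 * uOf D y - 0.5)..(0.502 : ℝ), gW D (bigP D ^ z / y)) -
              (0.502 - uOf D y)|
          = |(∫ z in (2 * uOf D y - 0.5)..(0.502 : ℝ), gW D (bigP D ^ z / y)) -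
              (0.502 - (2 * uOf D y - 0.5))| := by congr 1; ring
        _ ≤ 1 / 2 * Real.exp (-ell D ^ 10) * (0.502 - (2 * uOf D y - 0.5)) := hT
        _ ≤ 1 / 2 * Real.exp (-ell D ^ 10) * 0.002 := mul_le_mul_of_nonneg_left hlen hE0
    · -- split at `2u − 0.502`: a tail piece, then the symmetric piece `= 0.502 − u`
      rw [int_split hL hy 0.5 (2 * uOf D y - 0.502) 0.502]
      have hS := int_symm hD2 hy (0.502 - uOf D y)
      rw [show uOf D y - (0.502 - uOf D y) = 2 * uOf D y - 0.502 by ring,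
        show uOf D y + (0.502 - uOf D y) = 0.502 by ring] at hS
      rw [hS]
      have hT := int_small hL hy (a := 0.5) (b := 2 * uOf D y - 0.502) (by linarith) (by linarith)
      have hlen : 2 * uOf D y - 0.502 - 0.5 ≤ (0.002 : ℝ) := by linarith
      calc |(∫ z in (0.5 : ℝ)..(2 * uOf D y - 0.502), gW D (bigP D ^ z / y)) + (0.502 - uOf D y) -
              (0.502 - uOf D y)|
          = |∫ z in (0.5 : ℝ)..(2 * uOf D y - 0.502), gW D (bigP D ^ z / y)| := by congr 1; ring
        _ ≤ 1 / 2 * Real.exp (-ell D ^ 10) * (2 * uOf D y - 0.502 - 0.5) := hT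
        _ ≤ 1 / 2 * Real.exp (-ell D ^ 10) * 0.002 := mul_le_mul_of_nonneg_left hlen hE0
  -- assemble: `f̃(u) = 500(u − 0.5)`
  obtain ⟨a1, b1⟩ := abs_le.mp hI1
  obtain ⟨a2, b2⟩ := abs_le.mp hI2
  rw [gTilde1, ftilde]
  split_ifs with h1 h2
  · rw [abs_le]; constructor <;> linarith
  · exfalso; exact h1 ⟨by linarith, by linarith⟩
  · exfalso; exact h1 ⟨by linarith, by linarith⟩

/-- `𝓛⁻¹⁹ ≤ 𝓛⁻¹⁰` (`𝓛 ≥ 1`). [folklore] -/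
private theorem eta_le_inv10 (hL : 1 ≤ ell D) : (ell D ^ 19)⁻¹ ≤ (ell D ^ 10)⁻¹ :=
  inv_anti₀ (pow_pos (lt_of_lt_of_le one_pos hL) 10) (pow_le_pow_right₀ hL (by norm_num))

/-- `e^{−𝓛¹⁰} ≤ 𝓛⁻¹⁰`. [folklore] -/
private theorem exp_le_inv10 (hL : 0 < ell D) : Real.exp (-ell D ^ 10) ≤ (ell D ^ 10)⁻¹ := by
  rw [Real.exp_neg]
  exact inv_anti₀ (pow_pos hL 10) (by linarith [Real.add_one_le_exp (ell D ^ 10)])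

/-- `𝓛⁻¹⁹ ≤ 10⁻⁴` once `𝓛 ≥ 2`. [folklore] -/
private theorem eta_small (hL : 2 ≤ ell D) : (ell D ^ 19)⁻¹ ≤ 1 / 10000 := by
  have h : (2 : ℝ) ^ 19 ≤ ell D ^ 19 := pow_le_pow_left₀ (by norm_num) hL 19
  calc (ell D ^ 19)⁻¹ ≤ ((2 : ℝ) ^ 19)⁻¹ := inv_anti₀ (by norm_num) h
    _ ≤ 1 / 10000 := by norm_num

/-- **(11.3) on the window at `P^{0.502}`** (the case written out on p. 64): split `I₂` at `u + 𝓛⁻¹⁹`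
and `I₁` at `u − 𝓛⁻¹⁹`; slivers `≤ 2𝓛⁻¹⁹`, the rest by (4.2)/(4.3); `f̃(u) = 1 + O(𝓛⁻¹⁹)`.
[cite: Zhang2022LandauSiegel, §11 (11.3) p. 64] -/
private theorem part113_w502 (hD : 9 ≤ D) (hy : 0 < y)
    (hu1 : 0.502 - (ell D ^ 19)⁻¹ < uOf D y) (hu2 : uOf D y < 0.502 + (ell D ^ 19)⁻¹) :
    |ftilde (uOf D y) - gTilde1 D y| ≤ 4000 * (ell D ^ 10)⁻¹ := by
  have hL2 := two_le_ell hD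
  have hL : 0 < ell D := by linarith
  have hη0 : 0 < (ell D ^ 19)⁻¹ := by positivity
  have hηs := eta_small hL2
  have hη10 := eta_le_inv10 (D := D) (by linarith)
  have hE10 := exp_le_inv10 hL
  have hE0 : 0 ≤ 1 / 2 * Real.exp (-ell D ^ 10) := by positivity
  -- `I₂ = ∫_{0.502}^{u+η} + ∫_{u+η}^{0.504}`: a sliver and a plateau piece
  obtain ⟨c2, d2⟩ := int_sliver hL y (a := 0.502) (b := uOf D y + (ell D ^ 19)⁻¹) (by linarith)
  have hI2b := int_near_len hL hy (a := uOf D y + (ell D ^ 19)⁻¹) (b := 0.504) (by linarith) le_rfl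
  have hl2 : (0.504 : ℝ) - (uOf D y + (ell D ^ 19)⁻¹) ≤ 0.002 := by linarith
  obtain ⟨a2, b2⟩ := abs_le.mp (le_trans hI2b (mul_le_mul_of_nonneg_left hl2 hE0))
  -- `I₁ = ∫_{0.5}^{u−η} + ∫_{u−η}^{0.502}`: a tail piece and a sliver
  have hI1a := int_small hL hy (a := 0.5) (b := uOf D y - (ell D ^ 19)⁻¹) (by linarith) le_rfl
  have hl1 : uOf D y - (ell D ^ 19)⁻¹ - 0.5 ≤ (0.002 : ℝ) := by linarith
  obtain ⟨a1, b1⟩ := abs_le.mp (le_trans hI1a (mul_le_mul_of_nonneg_left hl1 hE0))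
  obtain ⟨c1, d1⟩ := int_sliver hL y (a := uOf D y - (ell D ^ 19)⁻¹) (b := 0.502) (by linarith)
  rw [gTilde1, int_split hL hy 0.5 (uOf D y - (ell D ^ 19)⁻¹) 0.502,
    int_split hL hy 0.502 (uOf D y + (ell D ^ 19)⁻¹) 0.504, ftilde]
  split_ifs with h1 h2
  · rw [abs_le]; constructor <;> linarith [h1.1, h1.2]
  · rw [abs_le]; constructor <;> linarith [h2.1, h2.2]
  · exfalso
    rcases not_and_or.mp h1 with h1 | h1
    · exact h1 (by linarith)
    · rcases not_and_or.mp h2 with h2 | h2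
      · exact h2 (by linarith [not_le.mp h1])
      · exact h2 (by linarith)

/-- **(11.3) on the window at `P^{0.5}`** ("the other cases are similar"): `I₂` is a plateau piece,
`I₁` = sliver + plateau; `f̃(u) = O(𝓛⁻¹⁹)`. [cite: Zhang2022LandauSiegel, §11 (11.3) p. 64] -/
private theorem part113_w500 (hD : 9 ≤ D) (hy : 0 < y)
    (hu1 : 0.5 - (ell D ^ 19)⁻¹ < uOf D y) (hu2 : uOf D y < 0.5 + (ell D ^ 19)⁻¹) :
    |ftilde (uOf D y) - gTilde1 D y| ≤ 4000 * (ell D ^ 10)⁻¹ := by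
  have hL2 := two_le_ell hD
  have hL : 0 < ell D := by linarith
  have hη0 : 0 < (ell D ^ 19)⁻¹ := by positivity
  have hηs := eta_small hL2
  have hη10 := eta_le_inv10 (D := D) (by linarith)
  have hE10 := exp_le_inv10 hL
  have hE0 : 0 ≤ 1 / 2 * Real.exp (-ell D ^ 10) := by positivity
  -- `I₂`: plateau
  have hI2 := int_near_len hL hy (a := 0.502) (b := 0.504) (by norm_num) (by linarith)
  obtain ⟨a2, b2⟩ := abs_le.mp hI2
  -- `I₁ = ∫_{0.5}^{u+η} + ∫_{u+η}^{0.502}`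
  obtain ⟨c1, d1⟩ := int_sliver hL y (a := 0.5) (b := uOf D y + (ell D ^ 19)⁻¹) (by linarith)
  have hI1b := int_near_len hL hy (a := uOf D y + (ell D ^ 19)⁻¹) (b := 0.502) (by linarith) le_rfl
  have hl1 : (0.502 : ℝ) - (uOf D y + (ell D ^ 19)⁻¹) ≤ 0.002 := by linarith
  obtain ⟨a1, b1⟩ := abs_le.mp (le_trans hI1b (mul_le_mul_of_nonneg_left hl1 hE0))
  rw [gTilde1, int_split hL hy 0.5 (uOf D y + (ell D ^ 19)⁻¹) 0.502, ftilde]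
  split_ifs with h1 h2
  · rw [abs_le]; constructor <;> linarith [h1.1, h1.2]
  · exfalso; linarith [h2.1]
  · have hu : uOf D y < 0.5 := by
      rcases not_and_or.mp h1 with h1 | h1
      · exact not_le.mp h1
      · exfalso; exact h1 (by linarith)
    rw [abs_le]; constructor <;> linarith

/-- **(11.3) on the window at `P^{0.504}`** ("the other cases are similar"): `I₁` is a tail piece,
`I₂` = tail + sliver; `f̃(u) = O(𝓛⁻¹⁹)`. [cite: Zhang2022LandauSiegel, §11 (11.3) p. 64] -/
private theorem part113_w504 (hD : 9 ≤ D) (hy : 0 < y)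
    (hu1 : 0.504 - (ell D ^ 19)⁻¹ < uOf D y) (hu2 : uOf D y < 0.504 + (ell D ^ 19)⁻¹) :
    |ftilde (uOf D y) - gTilde1 D y| ≤ 4000 * (ell D ^ 10)⁻¹ := by
  have hL2 := two_le_ell hD
  have hL : 0 < ell D := by linarith
  have hη0 : 0 < (ell D ^ 19)⁻¹ := by positivity
  have hηs := eta_small hL2
  have hη10 := eta_le_inv10 (D := D) (by linarith)
  have hE10 := exp_le_inv10 hL
  have hE0 : 0 ≤ 1 / 2 * Real.exp (-ell D ^ 10) := by positivity
  -- `I₁`: tail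
  have hI1 := int_small hL hy (a := 0.5) (b := 0.502) (by norm_num) (by linarith)
  obtain ⟨a1, b1⟩ := abs_le.mp hI1
  -- `I₂ = ∫_{0.502}^{u−η} + ∫_{u−η}^{0.504}`
  have hI2a := int_small hL hy (a := 0.502) (b := uOf D y - (ell D ^ 19)⁻¹) (by linarith) le_rfl
  have hl2 : uOf D y - (ell D ^ 19)⁻¹ - 0.502 ≤ (0.002 : ℝ) := by linarith
  obtain ⟨a2, b2⟩ := abs_le.mp (le_trans hI2a (mul_le_mul_of_nonneg_left hl2 hE0))
  obtain ⟨c2, d2⟩ := int_sliver hL y (a := uOf D y - (ell D ^ 19)⁻¹) (b := 0.504) (by linarith)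
  rw [gTilde1, int_split hL hy 0.502 (uOf D y - (ell D ^ 19)⁻¹) 0.504, ftilde]
  split_ifs with h1 h2
  · exfalso; linarith [h1.2]
  · rw [abs_le]; constructor <;> linarith [h2.1, h2.2]
  · have hu : 0.504 < uOf D y := by
      rcases not_and_or.mp h2 with h2 | h2
      · exfalso; exact h2 (by linarith)
      · exact not_le.mp h2
    rw [abs_le]; constructor <;> linarith

/-- **Lemma 11.1 of the manuscript, AS PRINTED, holds** (`Lemma111P`; constants `c = 1`,
`C = 4000`, all `D ≥ 9`, every real primitive `χ` — the statement does not involve `χ`): (11.2) on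
`[P^{0.5}η₊, P^{0.502}η₋] ∪ [P^{0.502}η₊, P^{0.504}η₋]` with error `≤ e^{−𝓛¹⁰}`, and (11.3) on the
three windows with error `≤ 4000·𝓛⁻¹⁰`. Kernel version of the printed proof (pp. 63–64) — the
`g`-facts (4.1)–(4.3) come from the tree's `Section4GaussianWeight`; case B uses the corrected step
(`StepU014corr`); the "similar" cases are carried out. DISCHARGES the §11 leaf "Lemma 11.1" in its
explicitly parenthesised form `Lemma111P` (module TYPING NOTE: definitionally the skeleton's node
once its bodies carry the same parentheses). [cite: Zhang2022LandauSiegel, §11 Lemma 11.1 pp. 63–64] -/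
theorem lemma111P_holds : Lemma111P := by
  refine ⟨1, one_pos, 4000, 9, fun D _ _ hD _ _ y => ⟨fun hy112 => ?_, fun hy113 => ?_⟩⟩
  · have hL : 0 < ell D := by linarith [two_le_ell hD]
    have hP : ∀ a : ℝ, 0 < bigP D ^ a * etaPM D 1 := fun a =>
      mul_pos (Real.rpow_pos_of_pos (Real.exp_pos _) a) (Real.exp_pos _)
    have hfin : |ftilde (Real.log y / Real.log (bigP D)) - gTilde1 D y| ≤ Real.exp (-ell D ^ 10) := by
      rcases hy112 with ⟨h1, h2⟩ | ⟨h1, h2⟩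
      · have hy : 0 < y := lt_of_lt_of_le (hP _) h1
        have hu1 := u_lower hL h1
        have hu2 := u_upper hL hy h2
        exact part112_lo hD hy (by linarith) (by linarith)
      · have hy : 0 < y := lt_of_lt_of_le (hP _) h1
        have hu1 := u_lower hL h1
        have hu2 := u_upper hL hy h2
        exact part112_hi hD hy (by linarith) (by linarith)
    calc |ftilde (Real.log y / Real.log (bigP D)) - gTilde1 D y| ≤ Real.exp (-ell D ^ 10) := hfin
      _ = 1 * Real.exp (-1 * ell D ^ 10) := by rw [one_mul, neg_one_mul]
      _ ≤ 4000 * Real.exp (-1 * ell D ^ 10) :=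
          mul_le_mul_of_nonneg_right (by norm_num) (Real.exp_pos _).le
  · have hL : 0 < ell D := by linarith [two_le_ell hD]
    obtain ⟨a, ha, h1, h2⟩ := hy113
    have hy : 0 < y :=
      lt_trans (mul_pos (Real.rpow_pos_of_pos (Real.exp_pos _) a) (Real.exp_pos _)) h1
    have hu1 := u_lower_lt hL h1
    have hu2 := u_upper_lt hL hy h2
    simp only [Finset.mem_insert, Finset.mem_singleton] at ha
    rcases ha with rfl | rfl | rfl
    · exact part113_w500 hD hy (by linarith) (by linarith)
    · exact part113_w502 hD hy (by linarith) (by linarith)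
    · exact part113_w504 hD hy (by linarith) (by linarith)

/-- The printed halves hold as well: (11.2) (`Eq112P`) and (11.3) (`Eq113P`).
[cite: Zhang2022LandauSiegel, §11 Lemma 11.1 p. 63] -/
theorem eq112P_and_eq113P_hold : Eq112P ∧ Eq113P := lemma111P_iff.mp lemma111P_holds

/-- `Eq112P` — `_holds` alias: projection `.1` of the in-file conjunction prover `eq112P_and_eq113P_hold` under the fact's
exact name (appended 2026-08-28, D-0026 bookkeeping: the proof term is a projection of the existing theorem of this
file; no statement, definition or attribute is edited; no new named fact; the ledger's debt table listed the fact
unproved). [cite: Zhang2022LandauSiegel, §11 Lemma 11.1 p. 63] -/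
theorem Eq112P_holds : Eq112P := eq112P_and_eq113P_hold.1

/-- `Eq113P` — `_holds` alias: projection `.2` of the in-file conjunction prover `eq112P_and_eq113P_hold` under the fact's
exact name (appended 2026-08-28, D-0026 bookkeeping: the proof term is a projection of the existing theorem of this
file; no statement, definition or attribute is edited; no new named fact; the ledger's debt table listed the fact
unproved). [cite: Zhang2022LandauSiegel, §11 Lemma 11.1 p. 63] -/
theorem Eq113P_holds : Eq113P := eq112P_and_eq113P_hold.2

/-- The proof node `Lemma111DedP` holds (its conclusion does). [cite: Zhang2022LandauSiegel, §11 Lemma 11.1 p. 63] -/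
theorem lemma111DedP_holds : Lemma111DedP := fun _ _ _ _ _ _ _ _ _ _ => lemma111P_holds

/-! ### The displayed proof steps, discharged one by one -/

/-- `y > 0` and the `u`-bounds in case A. [cite: Zhang2022LandauSiegel, §11 p. 63] -/
private theorem caseA_bounds (hL : 0 < ell D) (h : CaseA D y) :
    0 < y ∧ 0.502 + (ell D ^ 19)⁻¹ ≤ uOf D y ∧ uOf D y ≤ 0.503 := by
  have hy : 0 < y :=
    lt_of_lt_of_le (mul_pos (Real.rpow_pos_of_pos (Real.exp_pos _) _) (Real.exp_pos _)) h.1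
  have h1 := u_lower hL h.1
  have h2' : y ≤ bigP D ^ (0.503 : ℝ) * etaPM D 0 := by
    rw [etaPM, zero_mul, Real.exp_zero, mul_one]; exact h.2
  have h2 := u_upper hL hy h2'
  exact ⟨hy, by linarith, by linarith⟩

/-- `y > 0` and the `u`-bounds in case B. [cite: Zhang2022LandauSiegel, §11 p. 64] -/
private theorem caseB_bounds (hL : 0 < ell D) (h : CaseB D y) :
    0 < y ∧ 0.503 ≤ uOf D y ∧ uOf D y ≤ 0.504 - (ell D ^ 19)⁻¹ := by
  have hy : 0 < y := lt_of_lt_of_le (Real.rpow_pos_of_pos (Real.exp_pos _) _) h.1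
  have h1' : bigP D ^ (0.503 : ℝ) * etaPM D 0 ≤ y := by
    rw [etaPM, zero_mul, Real.exp_zero, mul_one]; exact h.1
  have h1 := u_lower hL h1'
  have h2 := u_upper hL hy h.2
  exact ⟨hy, by linarith, by linarith⟩

/-- `y > 0` and `|u − 0.502| < 𝓛⁻¹⁹` on the window. [cite: Zhang2022LandauSiegel, §11 p. 64] -/
private theorem window_bounds (hL : 0 < ell D) (h : Window0502 D y) :
    0 < y ∧ 0.502 - (ell D ^ 19)⁻¹ < uOf D y ∧ uOf D y < 0.502 + (ell D ^ 19)⁻¹ := by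
  have hy : 0 < y :=
    lt_trans (mul_pos (Real.rpow_pos_of_pos (Real.exp_pos _) _) (Real.exp_pos _)) h.1
  have h1 := u_lower_lt hL h.1
  have h2 := u_upper_lt hL hy h.2
  exact ⟨hy, by linarith, by linarith⟩

/-- **`StepU010` holds** (exact symmetric identity). [cite: Zhang2022LandauSiegel, §11 p. 63] -/
theorem stepU010_holds : StepU010 := by
  intro D hD y hc
  obtain ⟨hy, -, -⟩ := caseA_bounds (ell_pos hD) hc
  have hS := int_symm hD hy (uOf D y - 0.502)
  rwa [show uOf D y - (uOf D y - 0.502) = 0.502 by ring,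
    show uOf D y + (uOf D y - 0.502) = 2 * uOf D y - 0.502 by ring] at hS

/-- **`StepU013` holds** (exact symmetric identity). [cite: Zhang2022LandauSiegel, §11 p. 64] -/
theorem stepU013_holds : StepU013 := by
  intro D hD y hc
  obtain ⟨hy, -, -⟩ := caseB_bounds (ell_pos hD) hc
  have hS := int_symm hD hy (0.504 - uOf D y)
  rwa [show uOf D y - (0.504 - uOf D y) = 2 * uOf D y - 0.504 by ring,
    show uOf D y + (0.504 - uOf D y) = 0.504 by ring] at hS

/-- `½e^{−𝓛¹⁰}·ℓ ≤ 1·e^{−1·𝓛¹⁰}` for a length `ℓ ≤ 2`. [folklore] -/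
private theorem half_exp_mul_le (D : ℕ) {l : ℝ} (hl : l ≤ 2) :
    1 / 2 * Real.exp (-ell D ^ 10) * l ≤ 1 * Real.exp (-1 * ell D ^ 10) := by
  rw [neg_one_mul, one_mul]
  nlinarith [Real.exp_pos (-ell D ^ 10)]

/-- **`StepU011` holds** (plateau piece, (4.2)), `c = C = 1`. [cite: Zhang2022LandauSiegel, §11 p. 63] -/
theorem stepU011_holds : StepU011 := by
  refine ⟨1, one_pos, 1, 9, fun D _ _ hD _ _ y hc => ?_⟩
  have hL : 0 < ell D := by linarith [two_le_ell hD]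
  obtain ⟨hy, hu1, hu2⟩ := caseA_bounds hL hc
  have hη0 : 0 < (ell D ^ 19)⁻¹ := by positivity
  have hT := int_near_len hL hy (a := 2 * uOf D y - 0.502) (b := 0.504) (by linarith) (by linarith)
  rw [show (0.504 : ℝ) - (2 * uOf D y - 0.502) = 1.006 - 2 * uOf D y by ring] at hT
  exact le_trans hT (half_exp_mul_le D (by linarith))

/-- **`StepU012` holds** (tail piece, (4.3)), `c = C = 1`. [cite: Zhang2022LandauSiegel, §11 p. 63] -/
theorem stepU012_holds : StepU012 := by
  refine ⟨1, one_pos, 1, 9, fun D _ _ hD _ _ y hc => ?_⟩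
  have hL : 0 < ell D := by linarith [two_le_ell hD]
  obtain ⟨hy, hu1, -⟩ := caseA_bounds hL hc
  have hT := int_small hL hy (a := 0.5) (b := 0.502) (by norm_num) (by linarith)
  exact le_trans hT (half_exp_mul_le D (by norm_num))

/-- **`StepU014corr` holds** (the corrected case-B step: a tail piece). [cite: Zhang2022LandauSiegel, §11 p. 64] -/
theorem stepU014corr_holds : StepU014corr := by
  refine ⟨1, one_pos, 1, 9, fun D _ _ hD _ _ y hc => ?_⟩
  have hL : 0 < ell D := by linarith [two_le_ell hD]
  obtain ⟨hy, hu1, hu2⟩ := caseB_bounds hL hc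
  have hη0 : 0 < (ell D ^ 19)⁻¹ := by positivity
  have hT := int_small hL hy (a := 0.502) (b := 2 * uOf D y - 0.504) (by linarith) (by linarith)
  exact le_trans hT (half_exp_mul_le D (by linarith))

/-- **`StepU015` holds** (tail piece). [cite: Zhang2022LandauSiegel, §11 p. 64] -/
theorem stepU015_holds : StepU015 := by
  refine ⟨1, one_pos, 1, 9, fun D _ _ hD _ _ y hc => ?_⟩
  have hL : 0 < ell D := by linarith [two_le_ell hD]
  obtain ⟨hy, hu1, -⟩ := caseB_bounds hL hc
  have hηs := eta_small (two_le_ell hD)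
  have hT := int_small hL hy (a := 0.5) (b := 0.502) (by norm_num) (by linarith)
  exact le_trans hT (half_exp_mul_le D (by norm_num))

/-- **`StepU016a` holds**, `C = 5`: `|∫_{0.502}^{0.504} g − 1/500| ≤ 4𝓛⁻¹⁹ + 10⁻³e^{−𝓛¹⁰} ≤ 5𝓛⁻¹⁰`.
[cite: Zhang2022LandauSiegel, §11 p. 64] -/
theorem stepU016a_holds : StepU016a := by
  refine ⟨5, 9, fun D _ _ hD _ _ y hw => ?_⟩
  have hL2 := two_le_ell hD
  have hL : 0 < ell D := by linarith
  obtain ⟨hy, hu1, hu2⟩ := window_bounds hL hw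
  have hηs := eta_small hL2
  have hη10 := eta_le_inv10 (D := D) (by linarith)
  have hE10 := exp_le_inv10 hL
  have hE0 : 0 ≤ 1 / 2 * Real.exp (-ell D ^ 10) := by positivity
  obtain ⟨c2, d2⟩ := int_sliver hL y (a := 0.502) (b := uOf D y + (ell D ^ 19)⁻¹) (by linarith)
  have hI2b := int_near_len hL hy (a := uOf D y + (ell D ^ 19)⁻¹) (b := 0.504) (by linarith) le_rfl
  have hl2 : (0.504 : ℝ) - (uOf D y + (ell D ^ 19)⁻¹) ≤ 0.002 := by linarith
  obtain ⟨a2, b2⟩ := abs_le.mp (le_trans hI2b (mul_le_mul_of_nonneg_left hl2 hE0))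
  rw [int_split hL hy 0.502 (uOf D y + (ell D ^ 19)⁻¹) 0.504, abs_le]
  constructor <;> linarith

/-- **`StepU016b` holds**, `C = 5`: `|∫_{0.5}^{0.502} g| ≤ 2𝓛⁻¹⁹ + 10⁻³e^{−𝓛¹⁰}`.
[cite: Zhang2022LandauSiegel, §11 p. 64] -/
theorem stepU016b_holds : StepU016b := by
  refine ⟨5, 9, fun D _ _ hD _ _ y hw => ?_⟩
  have hL2 := two_le_ell hD
  have hL : 0 < ell D := by linarith
  obtain ⟨hy, hu1, hu2⟩ := window_bounds hL hw
  have hηs := eta_small hL2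
  have hη10 := eta_le_inv10 (D := D) (by linarith)
  have hE10 := exp_le_inv10 hL
  have hE0 : 0 ≤ 1 / 2 * Real.exp (-ell D ^ 10) := by positivity
  have hI1a := int_small hL hy (a := 0.5) (b := uOf D y - (ell D ^ 19)⁻¹) (by linarith) le_rfl
  have hl1 : uOf D y - (ell D ^ 19)⁻¹ - 0.5 ≤ (0.002 : ℝ) := by linarith
  obtain ⟨a1, b1⟩ := abs_le.mp (le_trans hI1a (mul_le_mul_of_nonneg_left hl1 hE0))
  obtain ⟨c1, d1⟩ := int_sliver hL y (a := uOf D y - (ell D ^ 19)⁻¹) (b := 0.502) (by linarith)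
  rw [int_split hL hy 0.5 (uOf D y - (ell D ^ 19)⁻¹) 0.502, abs_le]
  constructor <;> linarith

/-- **`StepU017` holds**, `C = 500`: `|f̃(u) − 1| ≤ 500𝓛⁻¹⁹`. [cite: Zhang2022LandauSiegel, §11 p. 64] -/
theorem stepU017_holds : StepU017 := by
  refine ⟨500, 9, fun D _ _ hD _ _ y hw => ?_⟩
  have hL2 := two_le_ell hD
  have hL : 0 < ell D := by linarith
  obtain ⟨hy, hu1, hu2⟩ := window_bounds hL hw
  have hηs := eta_small hL2
  have hη10 := eta_le_inv10 (D := D) (by linarith)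
  change |ftilde (uOf D y) - 1| ≤ 500 * (ell D ^ 10)⁻¹
  rw [ftilde]
  split_ifs with h1 h2
  · rw [abs_le]; constructor <;> linarith [h1.1, h1.2]
  · rw [abs_le]; constructor <;> linarith [h2.1, h2.2]
  · exfalso
    rcases not_and_or.mp h1 with h1 | h1
    · exact h1 (by linarith)
    · rcases not_and_or.mp h2 with h2 | h2
      · exact h2 (by linarith [not_le.mp h1])
      · exact h2 (by linarith)

end Discharge

/-! ## Bridges to the skeleton's objects and nodes

The skeleton's `gtilde1/gtilde2` bodies carry the same explicit parentheses as `gTilde1/gTilde2`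
(skeleton revision of 2026-08-26), so the twins of this file agree with the skeleton's objects and
nodes DEFINITIONALLY; in particular the banked leaf `Skeleton.Lemma111` (Lemma 11.1) follows from
`lemma111P_holds`. -/

section Bridges

/-- `gTilde1 = Skeleton.gtilde1` (same body). [cite: Zhang2022LandauSiegel, §11 p. 62] -/
theorem gTilde1_eq (D : ℕ) (y : ℝ) : gTilde1 D y = gtilde1 D y := rfl

/-- `gTilde2 = Skeleton.gtilde2` (same body). [cite: Zhang2022LandauSiegel, §11 p. 62] -/
theorem gTilde2_eq (D : ℕ) (y : ℝ) : gTilde2 D y = gtilde2 D y := rfl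

variable {D : ℕ} (χ : DirichletCharacter ℂ D) (x : Chr D) in
/-- `JTilde1 = Skeleton.Jtilde1`. [cite: Zhang2022LandauSiegel, §11 p. 63] -/
theorem JTilde1_eq (s : ℂ) : JTilde1 χ x s = Jtilde1 χ x s := rfl

variable {D : ℕ} (χ : DirichletCharacter ℂ D) (x : Chr D) in
/-- `JTilde2Bar = Skeleton.Jtilde2Bar`. [cite: Zhang2022LandauSiegel, §11 Lemma 11.2 p. 65] -/
theorem JTilde2Bar_eq (w : ℂ) : JTilde2Bar χ x w = Jtilde2Bar χ x w := rfl

variable {D : ℕ} (χ : DirichletCharacter ℂ D) (x : Chr D) in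
/-- `JTilde2 = Jtilde2` (the v1 object over `Skeleton.gtilde2`). [cite: Zhang2022LandauSiegel, §11 p. 63] -/
theorem JTilde2_eq (s : ℂ) : JTilde2 χ x s = Jtilde2 χ x s := rfl

/-- `Eq112P ↔ Eq112`. [cite: Zhang2022LandauSiegel, §11 (11.2) p. 63] -/
theorem eq112P_iff : Eq112P ↔ Eq112 := Iff.rfl

/-- `Eq113P ↔ Eq113`. [cite: Zhang2022LandauSiegel, §11 (11.3) p. 63] -/
theorem eq113P_iff : Eq113P ↔ Eq113 := Iff.rfl

/-- `TailsClaimP ↔ TailsClaim`. [cite: Zhang2022LandauSiegel, §11 p. 63] -/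
theorem tailsClaimP_iff : TailsClaimP ↔ TailsClaim := Iff.rfl

/-- `Lemma111P ↔ Skeleton.Lemma111`. [cite: Zhang2022LandauSiegel, §11 Lemma 11.1 p. 63] -/
theorem lemma111P_iff_lemma111 : Lemma111P ↔ Lemma111 := Iff.rfl

/-- **The skeleton leaf `Skeleton.Lemma111` (Lemma 11.1) HOLDS** — transport of `lemma111P_holds`
(the decl of record under the `Skeleton` name is the discharge holder's; this is the `Typed` twin).
[cite: Zhang2022LandauSiegel, §11 Lemma 11.1 pp. 63–64] -/
theorem lemma111_of_P : Lemma111 := lemma111P_holds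

/-- Hence both printed halves in their skeleton-object form: `Eq112 ∧ Eq113`.
[cite: Zhang2022LandauSiegel, §11 Lemma 11.1 p. 63] -/
theorem eq112_and_eq113_hold : Eq112 ∧ Eq113 := lemma111_iff.mp lemma111_of_P

/-- `Eq112` — `_holds` alias: projection `.1` of the in-file conjunction prover `eq112_and_eq113_hold` under the fact's
exact name (appended 2026-08-28, D-0026 bookkeeping: the proof term is a projection of the existing theorem of this
file; no statement, definition or attribute is edited; no new named fact; the ledger's debt table listed the fact
unproved). [cite: Zhang2022LandauSiegel, §11 Lemma 11.1 p. 63] -/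
theorem Eq112_holds : Eq112 := eq112_and_eq113_hold.1

/-- `Eq113` — `_holds` alias: projection `.2` of the in-file conjunction prover `eq112_and_eq113_hold` under the fact's
exact name (appended 2026-08-28, D-0026 bookkeeping: the proof term is a projection of the existing theorem of this
file; no statement, definition or attribute is edited; no new named fact; the ledger's debt table listed the fact
unproved). [cite: Zhang2022LandauSiegel, §11 Lemma 11.1 p. 63] -/
theorem Eq113_holds : Eq113 := eq112_and_eq113_hold.2

/-- … and the v1 proof node `Lemma111Ded` holds (its conclusion does).
[cite: Zhang2022LandauSiegel, §11 Lemma 11.1 p. 63] -/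
theorem lemma111Ded_holds : Lemma111Ded := fun _ _ _ _ _ _ _ _ _ _ => lemma111_of_P

end Bridges

end Literature.NumberTheory.LFunctions.Zhang2022.Typed.Sec11A

/-! ## `_holds` aliases (appended 2026-08-28)

The named fact(s) below are already theorems of the tree under another name; the `_holds`
alias records the discharge under the tree's naming convention (D-0026 bookkeeping: proof term =
the existing theorem, no statement or definition edited). -/

/-- `Lemma111` is a theorem of the tree (`Literature.NumberTheory.LFunctions.Zhang2022.Typed.Sec11A.lemma111_of_P`). [cite: Zhang2022LandauSiegel, §11 Lemma 11.1] -/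
theorem _root_.Literature.NumberTheory.LFunctions.Zhang2022.Skeleton.Lemma111_holds : _root_.Literature.NumberTheory.LFunctions.Zhang2022.Skeleton.Lemma111 :=
  _root_.Literature.NumberTheory.LFunctions.Zhang2022.Typed.Sec11A.lemma111_of_P
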